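import Literature.AlgebraicGeometry.MovasatiVillaflor2018.LinearCyclePeriods
import HarnessLib

/-!
# Two linear cycles of the Fermat variety: `(J^F : P₁)_e ∩ (J^F : P₂)_e` versus `(J^F : P₁ + P₂)_e`
# (Villaflor 2022, Prop. 1 and the proof of Thm. 3), with the exact excess

R. Villaflor Loyola, *Periods of complete intersection algebraic cycles*, manuscripta math. 167 (2022) 765–792
= arXiv:1812.03964 [Villaflor2022PeriodsCI] (text read: arXiv version, §3 p. 6, §9 p. 15).

* **Proposition 1** (§3, verbatim): "Consider the ideal `I := ⟨x_0^{d−1}, …, x_{2r−1}^{d−1}⟩ ⊆ ℂ[x_0, …, x_{2r−1}]`.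
  Let `d ≥ 3`, and `β₁, β₂, c₁, c₂ ∈ ℂ^×` with `β₁ ≠ β₂`. For `i = 1, 2`, define
  `R_i := c_i · ∏_{j=1}^{r} (x_{2j−2}^{d−1} − (β_i x_{2j−1})^{d−1}) / (x_{2j−2} − β_i x_{2j−1})`. Then
  `(I : R₁)_e ∩ (I : R₂)_e = (I : R₁ + R₂)_e` if and only if `e ≠ (d−2)·r`."
* **Theorem 3** (§1, p. 4): for the Fermat variety `X` of even dimension `n` and degree `d` and the two linear
  cycles `ℙ^{n/2} = {x_0 − ζ_{2d}x_1 = ⋯ = x_{n−2m−2} − ζ_{2d}x_{n−2m−1} = 0} ∩ ℙ^{n−m}`,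
  `ℙ̌^{n/2} = {x_0 − ζ_{2d}^{α_0}x_1 = ⋯ = x_{n−2m−2} − ζ_{2d}^{α_{n−2m−2}}x_{n−2m−1} = 0} ∩ ℙ^{n−m}`,
  `ℙ^{n−m} := {x_{n−2m} − ζ_{2d}x_{n−2m+1} = ⋯ = x_n − ζ_{2d}x_{n+1} = 0}`, `ℙ^{n/2} ∩ ℙ̌^{n/2} = ℙ^m`,
  `α_{2k} ∈ {3, 5, …, 2d−1}`: "for `m < n/2 − d/(d−2)`, `a, b ∈ ℤ∖{0}` and `δ := a·ℙ^{n/2} + b·ℙ̌^{n/2}` we have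
  `V_{[δ]} = V_{[ℙ^{n/2}]} ∩ V_{[ℙ̌^{n/2}]}` and the Hodge locus `V_{[δ]}` is smooth and reduced … On the other
  hand, for `m ≥ n/2 − d/(d−2)`, the Zariski tangent space of `V_{[δ]}` has dimension strictly bigger than the
  dimension of `V_{[ℙ^{n/2}]} ∩ V_{[ℙ̌^{n/2}]}`"; **Remark 7** (§9): Thm. 3 "is reduced to show that
  `T_0V_{[ℙ^{n/2}]} ∩ T_0V_{[ℙ̌^{n/2}]} = T_0V_{[δ]}` if and only if `m < n/2 − d/(d−2)`. By Corollaries 3 and [MV18,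
  Cor.] this is equivalent to the following algebraic equality `(J^F : P₁)_d ∩ (J^F : P₂)_d = (J^F : P₁ + P₂)_d`.
  Where `P₁ = R₁Q`, `P₂ = R₂Q`, `Q := ∏_{k ≥ n−2m even} (x_k^{d−1} − (ζ_{2d}x_{k+1})^{d−1})/(x_k − ζ_{2d}x_{k+1})`,
  `R₁ := c₁·∏_{k < n−2m even} (x_k^{d−1} − (ζ_{2d}x_{k+1})^{d−1})/(x_k − ζ_{2d}x_{k+1})`,
  `R₂ := c₂·∏_{k < n−2m even} (x_k^{d−1} − (ζ_{2d}^{α_k}x_{k+1})^{d−1})/(x_k − ζ_{2d}^{α_k}x_{k+1})`, for some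
  `c₁, c₂ ∈ ℂ^×`"; and the **proof of Thm. 3** (§9, p. 15): "We claim that
  `(J^F : P₁)_e ∩ (J^F : P₂)_e = (J^F : P₁ + P₂)_e` if and only if `e < (d−2)(n/2 − m)` or `e > (d−2)(n/2 + 1)`."

R. Kloosterman, Rend. Circ. Mat. Palermo 74 (2025) = arXiv:2312.12363 [Kloosterman2025]: **Lemma 2.9** (proof) /
**Lemma 3.12**: the excess `dim T_XNL([Y₁]+λ[Y₂]) − dim T_XNL([Y₁],[Y₂]) = dim I^{(λ)}_d/(I₁ ∩ I₂)_d` is at most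
`h_{I₁+I₂}(kd−2k−2)` (tree: `Kloosterman2025.excess_le_hilbert_sup`); **Proposition 4.1 / Example 4.2** (§4.1, the
Fermat hypersurface, `c = k − m` the codimension of `Π₁ ∩ Π₂` in the planes): `I₁ = ⟨y_{2i}, y_{2i+1}^{d−1}⟩`,
"`I₁ + I₂ = ⟨y_0, …, y_{2c−1}, y_{2c}^{d−1}, …, y_{k+c}^{d−1}, y_{k+c+1}, …, y_{2k+1}⟩`", the left kernel "has
dimension at most `h_{I₁+I₂}(kd−k−2)`. If `(c−1)(d−2) = 2` the latter quantity is one, if `(c−1)(d−2) = 1` the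
latter quantity is `k+1−c`", and (Ex. 4.2) the binomials "`λNM₂ − NM₁` [are] in the left kernel of `μ` … In
particular, the left kernel is nonzero."

## What this file PROVES (0 facts, 0 sorry) — the printed claims for ALL `(n, d, m)`, with the exact excess

Setting (Duque Franco–Villaflor's coordinates, as in `HodgeTheory/FermatLinearCycleGorensteinIdeal.lean`): a finite
set `τ` of PAIRS of variables, `Sum.inl j ↔ x_{2j}`, `Sum.inr j ↔ x_{2j+1}`, `S = K[x_i : i ∈ τ ⊕ τ]`, an exponent
`e = d − 1`, `J = (x_i^e)` (the Jacobian ideal of the Fermat polynomial of degree `d`), and two twist vectors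
`c, c' : τ → K`: the linear cycles `P_c = {x_{2j} = c_j x_{2j+1}}`, `P_{c'}` (genuine linear cycles of the Fermat
variety when `c_j^d = −1`; Villaflor: `c_j = ζ_{2d}`, `c'_j = ζ_{2d}^{α_{2j}}` on the first `r = n/2 − m` pairs and
`c'_j = c_j` on the remaining `m + 1` pairs), with period functionals `ℓ_c = fermatLinearCycleFunctional c e`
(`ℓ_c(x^s) = ∏_j c_j^{s(2j)}` if every pair of exponents sums to `d − 2`, else `0`; the inverse system of
`(J : P_c) = Ann(ℓ_c) = ⟨x_{2j} − c_jx_{2j+1}, x_i^{d−1}⟩`, DFV Rem. 7.1, tree `span_X_pow_colon_C_mul_…`,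
`annIdeal_fermatLinearCycleFunctional`). Let `E = {j : c_j = c'_j}` (the COMMON pairs, `#E = m + 1`), `D = τ ∖ E`
(`#D = r = n/2 − m`, the codimension `c` of Kloosterman), `σ₀ = #τ·(d−2)` the common socle degree, and
`box_E(b) = #{β ∈ [0, d−2]^E : |β| = b}` (the Hilbert function of `K[y_j : j ∈ E]/(y_j^{d−1})`).

* `hilbert_sup_annIdeal_le_card_box`: `h_{Ann ℓ_c + Ann ℓ_{c'}}(b) ≤ box_E(b)` (Kloosterman's
  "`I₁ + I₂ = ⟨y_0, …, y_{2c−1}, …⟩`": modulo `I₁ + I₂` every monomial touching a pair of `D` dies and the others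
  reduce to the `x_{2j+1}^β`, `β ∈ box_E`);
* `card_box_add_finrank_le`: for `w ≠ 0`, `d ≥ 3`, `c ≠ c'`, the binomials
  `(1+w)·x^{f₁(β)} − (c_{j₀} + w c'_{j₀})·x^{f₀(β)}` (`β ∈ box_E(k)`, `j₀ ∈ D`; Kloosterman's `λNM₂ − NM₁`) lie in
  `Ann(ℓ_c + wℓ_{c'})` and are linearly independent modulo `Ann(ℓ_c)`, whence
  `dim Ann(ℓ_c + wℓ_{c'})_a ≥ dim (Ann ℓ_c ∩ Ann ℓ_{c'})_a + box_E(a − r(d−2))`;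
* **`excess_eq_card_box`** (MAIN): for `d ≥ 3`, `c ≠ c'`, `w ≠ 0` and every `a ≤ σ₀`:
  **`dim_K Ann(ℓ_c + w ℓ_{c'})_a − dim_K (Ann ℓ_c ∩ Ann ℓ_{c'})_a = h_{Ann ℓ_c + Ann ℓ_{c'}}(σ₀ − a) = box_E(σ₀ − a)`**
  (squeezed between the two bounds by Kloosterman's Lemma 2.9 bound and the symmetry of `box_E`), and
  `hilbert_sup_annIdeal_eq_card_box`: `h_{Ann ℓ_c + Ann ℓ_{c'}} = box_E` in every degree;
* **`idealDegree_inf_eq_annIdeal_add_smul_iff`**: `(Ann ℓ_c)_a ∩ (Ann ℓ_{c'})_a = Ann(ℓ_c + wℓ_{c'})_a ⟺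
  a < r(d−2) ∨ a > σ₀` — the CLAIM of the proof of Thm. 3 (`r = n/2 − m`, `σ₀ = (d−2)(n/2+1)`), for every pair of
  distinct linear cycles with a common pairing of the coordinates and every `w ≠ 0`; colon form for the cycle
  polynomials `a_iP_{t_i}`: `idealDegree_colon_inf_eq_colon_add_iff` (via `exists_colon_add_eq_annIdeal`:
  `(J : a₁P_{t₁} + a₂P_{t₂}) = Ann(ℓ_{t₁} + wℓ_{t₂})` for some `w ≠ 0`, Macaulay's correspondence);
* **`Villaflor2022_prop1`**: Proposition 1 as printed, on the colon ideals `(I : R₁)`, `(I : R₂)`, `(I : R₁ + R₂)` of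
  `I = (x_i^{d−1}) ⊆ K[x_0, …, x_{2r−1}]` (`r ≥ 1` pairs, all differing: `E = ∅`), over any field;
* **`Villaflor2022_thm3_colon`**: the claim of the proof of Thm. 3 as printed, on `(J^F : P₁)`, `(J^F : P₂)`,
  `(J^F : P₁ + P₂)` for Villaflor's `P_i = R_iQ` (`n/2 + 1` pairs, the first `r = n/2 − m` differing), any field, any
  `ζ` and exponents with `ζ^{α_k} ≠ ζ`.

The period-matrix form (Movasati's `rank [p_{i+j}(a·ℙ + b·ℙ̌)]`, MV18 Thm. 2, Movasati's Thm. 13 `intdim` and §6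
Table 1) is derived in the companion file `TwoLinearCyclesPeriodMatrixRank.lean`. NOT formalised (cited only): the
transcendental identifications `T_0V_{[δ]} = (J^F : P_δ)_d` (Villaflor Cor. 3 / MV18), the scheme structure of
`V_{[δ]}`, Prop. 7 (`dim V_ℙ ∩ V_ℙ̌ = dim T_0V_ℙ ∩ T_0V_ℙ̌`) and Thm. 4.

HONEST FRAMING (cell pub-hlocus): certified instances and evidence bearing on the general Hodge conjecture; no claim.
-/

noncomputable section

open MvPolynomial Module Literature.RingTheory.MvPolynomial Literature.AlgebraicGeometry.Kloosterman2025
  Literature.AlgebraicGeometry.HodgeTheory Literature.AlgebraicGeometry.DuqueFrancoVillaflor2025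
  Literature.AlgebraicGeometry.MovasatiVillaflor2018

attribute [local instance] MvPolynomial.gradedAlgebra

namespace Literature.AlgebraicGeometry.Villaflor2022

variable {K : Type*} [Field K]

/-! ## Testing membership in an annihilator ideal on monomials -/

section MonomialTest

variable {σ : Type*}

/-- `monomial s a = a • x^s`. [folklore] -/
private theorem monomial_eq_smul_monomial_one (s : σ →₀ ℕ) (a : K) :
    monomial s a = a • monomial s (1 : K) := by
  rw [smul_monomial, smul_eq_mul, mul_one]

/-- `g ∈ Ann(ℓ)` iff `ℓ(g·x^m) = 0` for every monomial `x^m` (linearity in the second factor).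
[cite: Kloosterman2025, Lemma 2.1] -/
theorem mem_annIdeal_iff_forall_monomial (ℓ : MvPolynomial σ K →ₗ[K] K) (g : MvPolynomial σ K) :
    g ∈ annIdeal ℓ ↔ ∀ m : σ →₀ ℕ, ℓ (g * monomial m 1) = 0 := by
  refine ⟨fun h m => mem_annIdeal_iff.mp h _, fun h => mem_annIdeal_iff.mpr fun h' => ?_⟩
  rw [h'.as_sum, Finset.mul_sum, map_sum]
  refine Finset.sum_eq_zero fun m _ => ?_
  rw [monomial_eq_smul_monomial_one m (coeff m h'), mul_smul_comm, map_smul, h m, smul_zero]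

/-- `Ann(ℓ₁) ∩ Ann(ℓ₂) ⊆ Ann(ℓ₁ + w ℓ₂)` (the common part of the two left kernels lies in every member of the
pencil). [cite: Kloosterman2025, Notation 2.4] -/
theorem inf_annIdeal_le_annIdeal_add_smul {A : Type*} [CommRing A] [Algebra K A] (ℓ₁ ℓ₂ : A →ₗ[K] K) (w : K) :
    annIdeal ℓ₁ ⊓ annIdeal ℓ₂ ≤ annIdeal (ℓ₁ + w • ℓ₂) := by
  intro g hg
  refine mem_annIdeal_iff.mpr fun h => ?_
  rw [LinearMap.add_apply, LinearMap.smul_apply, mem_annIdeal_iff.mp hg.1 h, mem_annIdeal_iff.mp hg.2 h,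
    smul_zero, add_zero]

/-- **Kloosterman's excess bound, idealDegree form**: for two functionals `ℓ₁, ℓ₂` concentrated in degree `t`,
`a + b = t` and `w ≠ 0`: `dim Ann(ℓ₁ + wℓ₂)_a − dim (Ann ℓ₁ ∩ Ann ℓ₂)_a ≤ h_{Ann ℓ₁ + Ann ℓ₂}(b)` (the tree's
`excess_le_hilbert_sup` with the left kernel of `φ₁ + wφ₂` identified as `Ann(ℓ₁ + wℓ₂)_a`).
[cite: Kloosterman2025, Lemma 2.9 (proof), Lemma 3.12] -/
theorem excess_le_hilbert_sup' {σ' : Type*} [Finite σ'] {t : ℕ} {ℓ₁ ℓ₂ : MvPolynomial σ' K →ₗ[K] K}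
    (hℓ₁ : ∀ p, ℓ₁ (homogeneousComponent t p) = ℓ₁ p) (hℓ₂ : ∀ p, ℓ₂ (homogeneousComponent t p) = ℓ₂ p)
    {a b : ℕ} (hab : a + b = t) {w : K} (hw : w ≠ 0) :
    finrank K (idealDegree (annIdeal (ℓ₁ + w • ℓ₂)) a) - finrank K (idealDegree (annIdeal ℓ₁ ⊓ annIdeal ℓ₂) a) ≤
      finrank K (homogeneousSubmodule σ' K b) - finrank K (idealDegree (annIdeal ℓ₁ ⊔ annIdeal ℓ₂) b) := by
  have h := excess_le_hilbert_sup hℓ₁ hℓ₂ hab hw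
  rwa [ker_gradedMulForm (add_smul_homogeneousComponent hℓ₁ hℓ₂ w) hab,
    (Submodule.comapSubtypeEquivOfLe (idealDegree_le_homogeneousSubmodule _ _)).finrank_eq] at h

end MonomialTest

/-! ## Pairs of variables `τ ⊕ τ`: degrees, the monomials `∏ x_{2j+1}^{β_j}`, the functional on monomials -/

section Pairs

variable {τ : Type*} [Fintype τ]

/-- Degree bookkeeping on pairs: `|s| = Σ_j (s(2j) + s(2j+1))`. [folklore] -/
private theorem sum_eq_sum_pairs (s : τ ⊕ τ →₀ ℕ) : ∑ i, s i = ∑ j, (s (Sum.inl j) + s (Sum.inr j)) := by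
  rw [Fintype.sum_sum_type, Finset.sum_add_distrib]

/-- A monomial `x^s` is homogeneous of degree `|s|`. [folklore] -/
private theorem isHomogeneous_monomial_sum (s : τ ⊕ τ →₀ ℕ) :
    (monomial s (1 : K)).IsHomogeneous (∑ i, s i) :=
  isHomogeneous_monomial _ (by rw [Finsupp.degree_eq_sum])

/-- The exponent vector `inl j ↦ 0`, `inr j ↦ β_j` of the monomial `∏_j x_{2j+1}^{β_j}`.
[cite: Kloosterman2025, Proposition 4.1] -/
def inrExp (β : τ → ℕ) : τ ⊕ τ →₀ ℕ := Finsupp.equivFunOnFinite.symm (Sum.elim (fun _ => 0) β)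

/-- `inrExp β (inl j) = 0`. [cite: Kloosterman2025, Proposition 4.1] -/
@[simp] theorem inrExp_inl (β : τ → ℕ) (j : τ) : inrExp β (Sum.inl j) = 0 := by
  simp [inrExp]

/-- `inrExp β (inr j) = β_j`. [cite: Kloosterman2025, Proposition 4.1] -/
@[simp] theorem inrExp_inr (β : τ → ℕ) (j : τ) : inrExp β (Sum.inr j) = β j := by
  simp [inrExp]

/-- `|inrExp β| = |β|`. [folklore] -/
private theorem sum_inrExp (β : τ → ℕ) : ∑ i, inrExp β i = ∑ j, β j := by
  rw [sum_eq_sum_pairs]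
  simp

variable [DecidableEq τ]

/-- The period functional of `P_c` on a product of two monomials: `ℓ_c(x^s x^m) = ∏_j c_j^{s(2j)+m(2j)}` if every
pair of exponents of `x^{s+m}` sums to `e − 1 = d − 2`, and `0` otherwise (MV18 Thm. 1 in DFV's coordinates).
[cite: DuqueFrancoVillaflor2025Join, Remark 7.1] [cite: MovasatiVillaflor2018, Theorem 1] -/
theorem fermatLinearCycleFunctional_monomial_mul_monomial (c : τ → K) (e : ℕ) (s m : τ ⊕ τ →₀ ℕ) :
    fermatLinearCycleFunctional c e (monomial s 1 * monomial m 1) =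
      if ∀ j, (s (Sum.inl j) + s (Sum.inr j)) + (m (Sum.inl j) + m (Sum.inr j)) = e - 1 then
        ∏ j, c j ^ (s (Sum.inl j) + m (Sum.inl j)) else 0 := by
  rw [monomial_mul, one_mul, fermatLinearCycleFunctional_monomial, one_mul]
  simp only [Finsupp.coe_add, Pi.add_apply]
  have h : ∀ j, s (Sum.inl j) + m (Sum.inl j) + (s (Sum.inr j) + m (Sum.inr j)) =
      (s (Sum.inl j) + s (Sum.inr j)) + (m (Sum.inl j) + m (Sum.inr j)) := fun j => by ring
  simp only [h]

end Pairs

/-! ## The box `box_E(b) = {β ∈ [0, e−1]^E : |β| = b}` and its count -/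

section Box

variable {τ : Type*} [Fintype τ] [DecidableEq τ]

/-- The BOX of exponents on a set `E` of pairs: `{β : τ → ℕ | β_j ≤ e − 1 (= d − 2), β_j = 0 off E, |β| = b}` —
the monomial basis `∏_{j ∈ E} x_{2j+1}^{β_j}` of `(K[x_{2j+1} : j ∈ E]/(x_{2j+1}^e))_b` (Kloosterman's monomial
basis modulo `I₁ + I₂`). [cite: Kloosterman2025, Proposition 4.1] -/
def box (E : Finset τ) (e b : ℕ) : Finset (τ →₀ ℕ) :=
  (Finset.univ.finsuppAntidiag b).filter fun β => (∀ j, β j ≤ e - 1) ∧ ∀ j, j ∉ E → β j = 0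

/-- Membership in the box. [cite: Kloosterman2025, Proposition 4.1] -/
theorem mem_box {E : Finset τ} {e b : ℕ} {β : τ →₀ ℕ} :
    β ∈ box E e b ↔ (∑ j, β j = b) ∧ (∀ j, β j ≤ e - 1) ∧ ∀ j, j ∉ E → β j = 0 := by
  rw [box, Finset.mem_filter, Finset.mem_finsuppAntidiag]
  simp only [Finset.subset_univ, and_true]

/-- A member of `box_E(b)` has `Σ_{j ∈ E} β_j = b`. [cite: Kloosterman2025, Proposition 4.1] -/
theorem sum_eq_of_mem_box {E : Finset τ} {e b : ℕ} {β : τ →₀ ℕ} (hβ : β ∈ box E e b) :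
    ∑ j ∈ E, β j = b := by
  obtain ⟨hsum, -, hsupp⟩ := mem_box.mp hβ
  rw [← hsum]
  exact Finset.sum_subset (Finset.subset_univ E) fun j _ hj => hsupp j hj

/-- `box_E(b) = ∅` for `b > #E·(e−1)`. [cite: Kloosterman2025, Proposition 4.1] -/
theorem box_eq_empty_of_lt {E : Finset τ} {e b : ℕ} (hb : E.card * (e - 1) < b) : box E e b = ∅ := by
  refine Finset.eq_empty_of_forall_notMem fun β hβ => ?_
  have hsum := sum_eq_of_mem_box hβ
  obtain ⟨-, hle, -⟩ := mem_box.mp hβ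
  have h : ∑ j ∈ E, β j ≤ ∑ j ∈ E, (e - 1) := Finset.sum_le_sum fun j _ => hle j
  rw [Finset.sum_const, smul_eq_mul, hsum] at h
  omega

/-- The REVERSED exponent `β̄_j = (e − 1) − β_j` on `E` (Gorenstein symmetry of the box).
[cite: Kloosterman2025, Lemma 2.1] -/
def boxRev (E : Finset τ) (e : ℕ) (β : τ →₀ ℕ) : τ →₀ ℕ :=
  Finsupp.equivFunOnFinite.symm fun j => if j ∈ E then e - 1 - β j else 0

/-- Values of the reversed exponent. [cite: Kloosterman2025, Lemma 2.1] -/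
@[simp] theorem boxRev_apply (E : Finset τ) (e : ℕ) (β : τ →₀ ℕ) (j : τ) :
    boxRev E e β j = if j ∈ E then e - 1 - β j else 0 := by
  simp [boxRev]

/-- Reversal maps `box_E(k)` to `box_E(#E(e−1) − k)`. [cite: Kloosterman2025, Lemma 2.1] -/
theorem boxRev_mem_box {E : Finset τ} {e k : ℕ} {β : τ →₀ ℕ} (hβ : β ∈ box E e k) :
    boxRev E e β ∈ box E e (E.card * (e - 1) - k) := by
  have hsumE : ∑ j ∈ E, β j = k := sum_eq_of_mem_box hβ
  obtain ⟨-, hle, hsupp⟩ := mem_box.mp hβ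
  rw [mem_box]
  refine ⟨?_, fun j => ?_, fun j hj => ?_⟩
  · have h2 : ∑ j ∈ E, boxRev E e β j = ∑ j, boxRev E e β j :=
      Finset.sum_subset (Finset.subset_univ E) fun j _ hj => by rw [boxRev_apply, if_neg hj]
    have h1 : ∑ j ∈ E, boxRev E e β j = ∑ j ∈ E, (e - 1 - β j) :=
      Finset.sum_congr rfl fun j hj => by rw [boxRev_apply, if_pos hj]
    rw [← h2, h1, Finset.sum_tsub_distrib E fun j _ => hle j, Finset.sum_const, smul_eq_mul, hsumE]
  · rw [boxRev_apply]
    split_ifs <;> omega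
  · rw [boxRev_apply, if_neg hj]

/-- Reversal is an involution on the box. [cite: Kloosterman2025, Lemma 2.1] -/
theorem boxRev_boxRev {E : Finset τ} {e k : ℕ} {β : τ →₀ ℕ} (hβ : β ∈ box E e k) :
    boxRev E e (boxRev E e β) = β := by
  obtain ⟨-, hle, hsupp⟩ := mem_box.mp hβ
  ext j
  rw [boxRev_apply, boxRev_apply]
  by_cases hj : j ∈ E
  · rw [if_pos hj, if_pos hj]
    have := hle j
    omega
  · rw [if_neg hj, hsupp j hj]

/-- **Symmetry of the box count**: `box_E(k) = box_E(#E(e−1) − k)` for `k ≤ #E(e−1)` (the Hilbert function of the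
monomial complete intersection `(y_j^e)_{j ∈ E}` is symmetric about half its socle degree).
[cite: Kloosterman2025, Lemma 2.1] [cite: Villaflor2022PeriodsCI, Theorem 5] -/
theorem card_box_symm {E : Finset τ} {e k : ℕ} (hk : k ≤ E.card * (e - 1)) :
    (box E e k).card = (box E e (E.card * (e - 1) - k)).card := by
  refine Finset.card_nbij' (boxRev E e) (boxRev E e) (fun β hβ => ?_) (fun β hβ => ?_)
    (fun β hβ => ?_) (fun β hβ => ?_)
  · have hβ' : β ∈ box E e k := hβ
    exact boxRev_mem_box hβ'
  · have hβ' : β ∈ box E e (E.card * (e - 1) - k) := hβ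
    have h := boxRev_mem_box hβ'
    rw [Nat.sub_sub_self hk] at h
    exact h
  · have hβ' : β ∈ box E e k := hβ
    exact boxRev_boxRev hβ'
  · have hβ' : β ∈ box E e (E.card * (e - 1) - k) := hβ
    exact boxRev_boxRev hβ'

/-- **Re-indexing the box**: for an injection `ι : α ↪ τ` with image `E`, `box_E(b)` on `τ` is in bijection with the
full box `{β' ∈ [0, e−1]^α : |β'| = b}` on `α` (restriction / extension by zero).
[cite: Kloosterman2025, Proposition 4.1 ("After a permutation of coordinates")] -/
theorem card_box_eq_card_box_univ {α : Type*} [Fintype α] [DecidableEq α] (ι : α → τ)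
    (hι : Function.Injective ι) (e b : ℕ) :
    (box (Finset.univ.image ι) e b).card =
      ((Finset.univ.finsuppAntidiag b).filter fun β' : α →₀ ℕ => ∀ i, β' i ≤ e - 1).card := by
  have hmemα : ∀ β' : α →₀ ℕ,
      β' ∈ ((Finset.univ.finsuppAntidiag b).filter fun β' : α →₀ ℕ => ∀ i, β' i ≤ e - 1) ↔
        (∑ i, β' i = b) ∧ ∀ i, β' i ≤ e - 1 := by
    intro β'
    rw [Finset.mem_filter, Finset.mem_finsuppAntidiag]
    simp only [Finset.subset_univ, and_true]
  have hnot : ∀ j, j ∉ Finset.univ.image ι → j ∉ Set.range ι := by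
    intro j hj hj'
    obtain ⟨i, hi⟩ := hj'
    exact hj (Finset.mem_image.mpr ⟨i, Finset.mem_univ _, hi⟩)
  -- restriction `β ↦ β ∘ ι` and extension by zero `β' ↦ mapDomain ι β'`
  refine Finset.card_nbij' (fun β => Finsupp.equivFunOnFinite.symm fun i => β (ι i))
    (fun β' => Finsupp.mapDomain ι β') (fun β hβ => ?_) (fun β' hβ' => ?_) (fun β hβ => ?_) (fun β' hβ' => ?_)
  · have hβ₀ : β ∈ box (Finset.univ.image ι) e b := hβ
    have hsumE := sum_eq_of_mem_box hβ₀
    obtain ⟨-, hle, -⟩ := mem_box.mp hβ₀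
    have goal : (Finsupp.equivFunOnFinite.symm fun i => β (ι i)) ∈
        ((Finset.univ.finsuppAntidiag b).filter fun β' : α →₀ ℕ => ∀ i, β' i ≤ e - 1) := by
      rw [hmemα]
      refine ⟨?_, fun i => by simpa using hle (ι i)⟩
      simp only [Finsupp.coe_equivFunOnFinite_symm]
      rw [← hsumE, Finset.sum_image fun i _ i' _ h => hι h]
    exact goal
  · have hβ'₀ : β' ∈ ((Finset.univ.finsuppAntidiag b).filter fun β' : α →₀ ℕ => ∀ i, β' i ≤ e - 1) := hβ'
    rw [hmemα] at hβ'₀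
    obtain ⟨hsum, hle⟩ := hβ'₀
    have goal : Finsupp.mapDomain ι β' ∈ box (Finset.univ.image ι) e b := by
      rw [mem_box]
      refine ⟨?_, fun j => ?_, fun j hj => Finsupp.mapDomain_notin_range _ _ (hnot j hj)⟩
      · rw [← Finset.sum_subset (Finset.subset_univ (Finset.univ.image ι))
          (fun j _ hj => Finsupp.mapDomain_notin_range _ _ (hnot j hj)),
          Finset.sum_image fun i _ i' _ h => hι h]
        simp only [Finsupp.mapDomain_apply hι]
        exact hsum
      · by_cases hj : j ∈ Set.range ι
        · obtain ⟨i, rfl⟩ := hj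
          rw [Finsupp.mapDomain_apply hι]
          exact hle i
        · rw [Finsupp.mapDomain_notin_range _ _ hj]
          exact Nat.zero_le _
    exact goal
  · have hβ₀ : β ∈ box (Finset.univ.image ι) e b := hβ
    obtain ⟨-, -, hsupp⟩ := mem_box.mp hβ₀
    show Finsupp.mapDomain ι (Finsupp.equivFunOnFinite.symm fun i => β (ι i)) = β
    ext j
    by_cases hj : j ∈ Set.range ι
    · obtain ⟨i, rfl⟩ := hj
      rw [Finsupp.mapDomain_apply hι]
      simp
    · rw [Finsupp.mapDomain_notin_range _ _ hj, hsupp j fun h => hj ?_]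
      obtain ⟨i, -, hi⟩ := Finset.mem_image.mp h
      exact ⟨i, hi⟩
  · show (Finsupp.equivFunOnFinite.symm fun i => Finsupp.mapDomain ι β' (ι i)) = β'
    ext i
    simp [Finsupp.mapDomain_apply hι]

omit [Fintype τ] [DecidableEq τ] in
/-- Every finite set `E` is the image of an injection from `Fin #E`. [folklore] -/
private theorem exists_injective_image_eq (E : Finset τ) :
    ∃ ι : Fin E.card → τ, Function.Injective ι ∧ ∀ [DecidableEq τ], Finset.univ.image ι = E := by
  refine ⟨fun i => (E.equivFin.symm i : τ), fun i i' h => E.equivFin.symm.injective (Subtype.ext h), ?_⟩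
  intro _
  ext j
  constructor
  · intro hj
    obtain ⟨i, -, rfl⟩ := Finset.mem_image.mp hj
    exact (E.equivFin.symm i).2
  · intro hj
    exact Finset.mem_image.mpr ⟨E.equivFin ⟨j, hj⟩, Finset.mem_univ _, by simp⟩

/-- **`box_E(b)` is the Hilbert function of `#E` free variables with `e`-th powers killed**:
`box_E(b) = ciHilbert [e, …, e] (#E entries) b = #{β' ∈ [0,e−1]^{#E} : |β'| = b}` (`e ≥ 1`).
[cite: Kloosterman2025, Proposition 4.1] [cite: Kloosterman2023, §2 eq. (1)] -/
theorem card_box_eq_ciHilbert (E : Finset τ) {e : ℕ} (he : 1 ≤ e) (b : ℕ) :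
    (box E e b).card = Kloosterman2023.ciHilbert (List.replicate E.card e) b := by
  obtain ⟨ι, hι, hE⟩ := exists_injective_image_eq E
  rw [show (box E e b).card = (box (Finset.univ.image ι) e b).card by rw [hE],
    card_box_eq_card_box_univ ι hι e b, ← List.ofFn_const]
  convert card_filter_finsuppAntidiag_eq_ciHilbert (fun _ : Fin E.card => e) (fun _ => he) b using 3

/-- **`box_E(b) ≠ ∅ ⟺ b ≤ #E·(e − 1)`** (`e ≥ 1`; Voisin II Cor. 6.20 (i) for the monomial complete intersection in
the variables of `E`, tree `hilbert_span_X_pow_pos_iff`). [cite: VoisinHodgeII2003, Cor. 6.20 (i)]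
[cite: Kloosterman2025, Proposition 4.1] -/
theorem card_box_pos_iff (E : Finset τ) {e : ℕ} (he : 1 ≤ e) (b : ℕ) :
    0 < (box E e b).card ↔ b ≤ E.card * (e - 1) := by
  obtain ⟨ι, hι, hE⟩ := exists_injective_image_eq E
  have h := hilbert_span_X_pow_pos_iff (K := ℚ) (ι := Fin E.card) he (k := b)
  rw [hilbert_span_X_pow_eq_card (K := ℚ) he b, Fintype.card_fin] at h
  rw [show (box E e b).card = (box (Finset.univ.image ι) e b).card by rw [hE],
    card_box_eq_card_box_univ ι hι e b]
  convert h using 3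

end Box

/-! ## Two twist vectors: the common pairs `E`, and the spanning bound for `Ann ℓ_c + Ann ℓ_{c'}` -/

section TwoCycles

variable {τ : Type*} [Fintype τ] [DecidableEq τ] [DecidableEq K] (c c' : τ → K) (e : ℕ)

/-- The COMMON pairs of the two linear cycles `P_c`, `P_{c'}`: `E = {j : c_j = c'_j}` (`#E = m + 1` when
`P_c ∩ P_{c'} = ℙ^m`; Villaflor: the pairs of `Q`). [cite: Villaflor2022PeriodsCI, Remark 7] -/
def agreePairs : Finset τ := Finset.univ.filter fun j => c j = c' j

/-- The DIFFERING pairs `D = {j : c_j ≠ c'_j}` (`#D = r = n/2 − m`; Villaflor: the pairs of `R₁, R₂`; Kloosterman's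
codimension `c`). [cite: Villaflor2022PeriodsCI, Remark 7] [cite: Kloosterman2025, Proposition 4.1] -/
def diffPairs : Finset τ := Finset.univ.filter fun j => ¬ c j = c' j

omit [Field K] [DecidableEq τ] in
/-- `j ∈ E ↔ c_j = c'_j`. [cite: Villaflor2022PeriodsCI, Remark 7] -/
@[simp] theorem mem_agreePairs {j : τ} : j ∈ agreePairs c c' ↔ c j = c' j := by
  simp [agreePairs]

omit [Field K] [DecidableEq τ] in
/-- `j ∈ D ↔ c_j ≠ c'_j`. [cite: Villaflor2022PeriodsCI, Remark 7] -/
@[simp] theorem mem_diffPairs {j : τ} : j ∈ diffPairs c c' ↔ c j ≠ c' j := by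
  simp [diffPairs]

omit [Field K] [DecidableEq τ] in
/-- `#E + #D = #τ` (`(m+1) + (n/2−m) = n/2+1`). [cite: Villaflor2022PeriodsCI, Remark 7] -/
theorem card_agreePairs_add_card_diffPairs : (agreePairs c c').card + (diffPairs c c').card = Fintype.card τ := by
  rw [agreePairs, diffPairs, Finset.card_filter_add_card_filter_not, Finset.card_univ]

/-- The span of the box monomials `∏_{j ∈ E} x_{2j+1}^{β_j}`, `β ∈ box_E(b)`.
[cite: Kloosterman2025, Proposition 4.1] -/
def boxSpan (b : ℕ) : Submodule K (MvPolynomial (τ ⊕ τ) K) :=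
  Submodule.span K (Set.range fun β : ↥(box (agreePairs c c') e b) => monomial (inrExp ⇑β.1) (1 : K))

/-- The box span has dimension at most `box_E(b)`. [cite: Kloosterman2025, Proposition 4.1] -/
theorem finrank_boxSpan_le (b : ℕ) : finrank K (boxSpan c c' e b) ≤ (box (agreePairs c c') e b).card := by
  have h := finrank_range_le_card (R := K)
    (fun β : ↥(box (agreePairs c c') e b) => monomial (inrExp ⇑β.1) (1 : K))
  rw [Fintype.card_coe] at h
  exact h

/-- The box span is finite-dimensional. [cite: Kloosterman2025, Proposition 4.1] -/
instance boxSpan.finite (b : ℕ) : Module.Finite K (boxSpan c c' e b) :=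
  Module.Finite.span_of_finite K (Set.finite_range _)

omit [DecidableEq τ] [DecidableEq K] in
/-- For a DIFFERING pair `j ∈ D` both variables `x_{2j}, x_{2j+1}` lie in `Ann ℓ_c + Ann ℓ_{c'}` (from the generators
`x_{2j} − c_jx_{2j+1} ∈ Ann ℓ_c`, `x_{2j} − c'_jx_{2j+1} ∈ Ann ℓ_{c'}`, `c_j ≠ c'_j`; Kloosterman:
"`I₁ + I₂ = ⟨y_0, …, y_{2c−1}, …⟩`"). [cite: Kloosterman2025, Proposition 4.1] [cite: DuqueFrancoVillaflor2025Join, Remark 7.1] -/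
theorem X_mem_sup_annIdeal (he : 1 ≤ e) {j : τ} (hj : c j ≠ c' j) {i : τ ⊕ τ}
    (hi : i = Sum.inl j ∨ i = Sum.inr j) :
    (X i : MvPolynomial (τ ⊕ τ) K) ∈
      annIdeal (fermatLinearCycleFunctional c e) ⊔ annIdeal (fermatLinearCycleFunctional c' e) := by
  have h1 : (X (Sum.inl j) : MvPolynomial (τ ⊕ τ) K) - C (c j) * X (Sum.inr j) ∈
      annIdeal (fermatLinearCycleFunctional c e) := by
    rw [annIdeal_fermatLinearCycleFunctional c e he]
    exact Ideal.subset_span (Or.inl ⟨j, rfl⟩)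
  have h2 : (X (Sum.inl j) : MvPolynomial (τ ⊕ τ) K) - C (c' j) * X (Sum.inr j) ∈
      annIdeal (fermatLinearCycleFunctional c' e) := by
    rw [annIdeal_fermatLinearCycleFunctional c' e he]
    exact Ideal.subset_span (Or.inl ⟨j, rfl⟩)
  have hinr : (X (Sum.inr j) : MvPolynomial (τ ⊕ τ) K) ∈
      annIdeal (fermatLinearCycleFunctional c e) ⊔ annIdeal (fermatLinearCycleFunctional c' e) := by
    have h3 : C (c' j - c j) * (X (Sum.inr j) : MvPolynomial (τ ⊕ τ) K) ∈
        annIdeal (fermatLinearCycleFunctional c e) ⊔ annIdeal (fermatLinearCycleFunctional c' e) := by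
      have heq : C (c' j - c j) * (X (Sum.inr j) : MvPolynomial (τ ⊕ τ) K) =
          (X (Sum.inl j) - C (c j) * X (Sum.inr j)) - (X (Sum.inl j) - C (c' j) * X (Sum.inr j)) := by
        rw [map_sub]
        ring
      rw [heq]
      exact Submodule.sub_mem _ (Ideal.mem_sup_left h1) (Ideal.mem_sup_right h2)
    have h4 := Ideal.mul_mem_left _ (C (c' j - c j)⁻¹) h3
    rwa [← mul_assoc, ← map_mul, inv_mul_cancel₀ (sub_ne_zero.mpr (Ne.symm hj)), map_one, one_mul] at h4
  rcases hi with rfl | rfl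
  · have heq : (X (Sum.inl j) : MvPolynomial (τ ⊕ τ) K) =
        (X (Sum.inl j) - C (c j) * X (Sum.inr j)) + C (c j) * X (Sum.inr j) := by ring
    rw [heq]
    exact Submodule.add_mem _ (Ideal.mem_sup_left h1) (Ideal.mul_mem_left _ _ hinr)
  · exact hinr

omit [DecidableEq τ] [DecidableEq K] in
/-- A monomial touching a differing pair lies in `Ann ℓ_c + Ann ℓ_{c'}`. [cite: Kloosterman2025, Proposition 4.1] -/
theorem monomial_mem_sup_annIdeal_of_ne (he : 1 ≤ e) {s : τ ⊕ τ →₀ ℕ} {j : τ} (hj : c j ≠ c' j)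
    (hs : s (Sum.inl j) ≠ 0 ∨ s (Sum.inr j) ≠ 0) :
    monomial s (1 : K) ∈
      annIdeal (fermatLinearCycleFunctional c e) ⊔ annIdeal (fermatLinearCycleFunctional c' e) := by
  obtain ⟨i, hi, hsi⟩ : ∃ i, (i = Sum.inl j ∨ i = Sum.inr j) ∧ s i ≠ 0 := by
    rcases hs with h | h
    · exact ⟨_, Or.inl rfl, h⟩
    · exact ⟨_, Or.inr rfl, h⟩
  have hsplit : monomial s (1 : K) = monomial (s - Finsupp.single i 1) 1 * X i := by
    rw [show (X i : MvPolynomial (τ ⊕ τ) K) = monomial (Finsupp.single i 1) 1 from rfl, monomial_mul, mul_one,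
      tsub_add_cancel_of_le]
    exact Finsupp.single_le_iff.mpr (Nat.one_le_iff_ne_zero.mpr hsi)
  rw [hsplit]
  exact Ideal.mul_mem_left _ _ (X_mem_sup_annIdeal c c' e he hj hi)

omit [DecidableEq K] in
/-- A monomial with a pair of exponents summing to `≥ e` lies in `Ann ℓ_c` (it lies in
`⟨x_{2j} − c_jx_{2j+1}, x_{2j}^e, x_{2j+1}^e⟩`). [cite: DuqueFrancoVillaflor2025Join, Remark 7.1] -/
theorem monomial_mem_annIdeal_of_le {s : τ ⊕ τ →₀ ℕ} {j : τ} (hs : e ≤ s (Sum.inl j) + s (Sum.inr j))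
    (he : 1 ≤ e) : monomial s (1 : K) ∈ annIdeal (fermatLinearCycleFunctional c e) := by
  rw [mem_annIdeal_iff_forall_monomial]
  intro m
  rw [fermatLinearCycleFunctional_monomial_mul_monomial, if_neg]
  intro h
  have := h j
  omega

omit [DecidableEq K] in
/-- `x^s ≡ (∏_j c_j^{s(2j)}) · ∏_j x_{2j+1}^{s(2j)+s(2j+1)}` modulo `Ann ℓ_c` (substitute `x_{2j} = c_j x_{2j+1}`).
[cite: DuqueFrancoVillaflor2025Join, Remark 7.1] -/
theorem monomial_sub_smul_monomial_inrExp_mem (s : τ ⊕ τ →₀ ℕ) :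
    monomial s (1 : K) - (∏ j, c j ^ s (Sum.inl j)) •
        monomial (inrExp fun j => s (Sum.inl j) + s (Sum.inr j)) 1 ∈
      annIdeal (fermatLinearCycleFunctional c e) := by
  rw [mem_annIdeal_iff_forall_monomial]
  intro m
  rw [sub_mul, smul_mul_assoc, map_sub, map_smul, fermatLinearCycleFunctional_monomial_mul_monomial,
    fermatLinearCycleFunctional_monomial_mul_monomial]
  simp only [inrExp_inl, inrExp_inr, zero_add]
  split_ifs with h
  · rw [smul_eq_mul, ← Finset.prod_mul_distrib, sub_eq_zero]
    exact Finset.prod_congr rfl fun j _ => pow_add _ _ _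
  · rw [smul_zero, sub_zero]

/-- Every monomial of degree `b` lies in `(Ann ℓ_c + Ann ℓ_{c'})_b + span{x_{2j+1}^β : β ∈ box_E(b)}`.
[cite: Kloosterman2025, Proposition 4.1] -/
theorem monomial_mem_idealDegree_sup_boxSpan (he : 1 ≤ e) {b : ℕ} {s : τ ⊕ τ →₀ ℕ} (hdeg : ∑ i, s i = b) :
    monomial s (1 : K) ∈
      idealDegree (annIdeal (fermatLinearCycleFunctional c e) ⊔ annIdeal (fermatLinearCycleFunctional c' e)) b ⊔
        boxSpan c c' e b := by
  have hhom : (monomial s (1 : K)).IsHomogeneous b := hdeg ▸ isHomogeneous_monomial_sum s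
  by_cases h1 : ∃ j, c j ≠ c' j ∧ (s (Sum.inl j) ≠ 0 ∨ s (Sum.inr j) ≠ 0)
  · obtain ⟨j, hj, hs⟩ := h1
    exact Submodule.mem_sup_left ⟨monomial_mem_sup_annIdeal_of_ne c c' e he hj hs, hhom⟩
  push Not at h1
  by_cases h2 : ∃ j, e ≤ s (Sum.inl j) + s (Sum.inr j)
  · obtain ⟨j, hj⟩ := h2
    exact Submodule.mem_sup_left ⟨Ideal.mem_sup_left (monomial_mem_annIdeal_of_le c e hj he), hhom⟩
  push Not at h2
  -- the reduced exponent `β_j = s(2j) + s(2j+1)` lies in the box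
  let β : τ →₀ ℕ := Finsupp.equivFunOnFinite.symm fun j => s (Sum.inl j) + s (Sum.inr j)
  have hβapp : ∀ j, β j = s (Sum.inl j) + s (Sum.inr j) := fun j => by simp [β]
  have hβcoe : (⇑β : τ → ℕ) = fun j => s (Sum.inl j) + s (Sum.inr j) := funext hβapp
  have hβmem : β ∈ box (agreePairs c c') e b := by
    rw [mem_box]
    refine ⟨?_, fun j => ?_, fun j hj => ?_⟩
    · rw [← hdeg, sum_eq_sum_pairs]
      exact Finset.sum_congr rfl fun j _ => hβapp j
    · rw [hβapp]
      have := h2 j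
      omega
    · rw [mem_agreePairs] at hj
      rw [hβapp, (h1 j hj).1, (h1 j hj).2]
  have hW : monomial (inrExp ⇑β) (1 : K) ∈ boxSpan c c' e b :=
    Submodule.subset_span ⟨⟨β, hβmem⟩, rfl⟩
  have hcong := monomial_sub_smul_monomial_inrExp_mem c e s (K := K)
  rw [← hβcoe] at hcong
  have hhomβ : (monomial (inrExp ⇑β) (1 : K)).IsHomogeneous b := by
    have h := isHomogeneous_monomial_sum (K := K) (inrExp ⇑β)
    rwa [sum_inrExp, hβcoe, ← sum_eq_sum_pairs, hdeg] at h
  have hsplit : monomial s (1 : K) = (monomial s 1 - (∏ j, c j ^ s (Sum.inl j)) • monomial (inrExp ⇑β) 1) +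
      (∏ j, c j ^ s (Sum.inl j)) • monomial (inrExp ⇑β) 1 := by rw [sub_add_cancel]
  rw [hsplit]
  refine Submodule.add_mem _ (Submodule.mem_sup_left ⟨Ideal.mem_sup_left hcong, ?_⟩)
    (Submodule.mem_sup_right (Submodule.smul_mem _ _ hW))
  exact (mem_homogeneousSubmodule b _).mp (Submodule.sub_mem _ ((mem_homogeneousSubmodule b _).mpr hhom)
    (Submodule.smul_mem _ _ ((mem_homogeneousSubmodule b _).mpr hhomβ)))

/-- `S_b ⊆ (Ann ℓ_c + Ann ℓ_{c'})_b + span{x_{2j+1}^β : β ∈ box_E(b)}`. [cite: Kloosterman2025, Proposition 4.1] -/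
theorem homogeneousSubmodule_le_idealDegree_sup_boxSpan (he : 1 ≤ e) (b : ℕ) :
    homogeneousSubmodule (τ ⊕ τ) K b ≤
      idealDegree (annIdeal (fermatLinearCycleFunctional c e) ⊔ annIdeal (fermatLinearCycleFunctional c' e)) b ⊔
        boxSpan c c' e b := by
  intro p hp
  have hp' : p.IsHomogeneous b := (mem_homogeneousSubmodule b p).mp hp
  rw [p.as_sum]
  refine Submodule.sum_mem _ fun s hs => ?_
  have hdeg' : s.degree = b := by
    rw [Finsupp.degree_eq_weight_one]
    exact hp' (mem_support_iff.mp hs)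
  have hdeg : ∑ i, s i = b := by
    rw [← Finsupp.degree_eq_sum]
    exact hdeg'
  rw [monomial_eq_smul_monomial_one]
  exact Submodule.smul_mem _ _ (monomial_mem_idealDegree_sup_boxSpan c c' e he hdeg)

/-- **`h_{Ann ℓ_c + Ann ℓ_{c'}}(b) ≤ box_E(b)`**: `(S/(Ann ℓ_c + Ann ℓ_{c'}))_b` is spanned by the monomials
`∏_{j ∈ E} x_{2j+1}^{β_j}`, `β ∈ box_E(b)` (Kloosterman: `I₁ + I₂ = ⟨y_0, …, y_{2c−1}, y_{2c}^{d−1}, …⟩` has the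
monomial basis of `#E = k + 1 − c` variables with `(d−1)`-st powers killed).
[cite: Kloosterman2025, Proposition 4.1] [cite: Villaflor2022PeriodsCI, Theorem 3 (proof)] -/
theorem hilbert_sup_annIdeal_le_card_box (he : 1 ≤ e) (b : ℕ) :
    finrank K (homogeneousSubmodule (τ ⊕ τ) K b) -
        finrank K (idealDegree (annIdeal (fermatLinearCycleFunctional c e) ⊔
          annIdeal (fermatLinearCycleFunctional c' e)) b) ≤ (box (agreePairs c c') e b).card := by
  have h1 := Submodule.finrank_mono (homogeneousSubmodule_le_idealDegree_sup_boxSpan c c' e he b)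
  have h2 := Submodule.finrank_sup_add_finrank_inf_eq
    (idealDegree (annIdeal (fermatLinearCycleFunctional c e) ⊔ annIdeal (fermatLinearCycleFunctional c' e)) b)
    (boxSpan c c' e b)
  have h3 := finrank_boxSpan_le c c' e b
  omega


/-! ## The witnesses `(1+w)·x^{f₁(β)} − (c_{j₀} + w c'_{j₀})·x^{f₀(β)}` (Kloosterman's binomials `λNM₂ − NM₁`) -/

/-- The pair-sum profile of the witnesses: `β_j` on the common pairs, `e − 1` on the differing ones.
[cite: Kloosterman2025, Example 4.2] -/
def pairProfile (β : τ → ℕ) (j : τ) : ℕ := if c j = c' j then β j else e - 1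

/-- `f₀(β)`: the exponent of `∏_{j ∈ E} x_{2j+1}^{β_j} · ∏_{j ∈ D} x_{2j+1}^{e−1}` (Kloosterman's `N·M₁`).
[cite: Kloosterman2025, Example 4.2] -/
def wExp0 (β : τ → ℕ) : τ ⊕ τ →₀ ℕ :=
  Finsupp.equivFunOnFinite.symm (Sum.elim (fun _ => 0) (pairProfile c c' e β))

/-- `f₁(β)`: as `f₀(β)` but with the differing pair `j₀` carrying `x_{2j₀} x_{2j₀+1}^{e−2}` instead of `x_{2j₀+1}^{e−1}`
(Kloosterman's `N·M₂`). [cite: Kloosterman2025, Example 4.2] -/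
def wExp1 (j0 : τ) (β : τ → ℕ) : τ ⊕ τ →₀ ℕ :=
  Finsupp.equivFunOnFinite.symm (Sum.elim (fun j => if j = j0 then 1 else 0)
    fun j => if j = j0 then e - 2 else pairProfile c c' e β j)

omit [Field K] [DecidableEq τ] in
/-- Values of `f₀(β)` on the first variables of the pairs. [cite: Kloosterman2025, Example 4.2] -/
@[simp] theorem wExp0_inl (β : τ → ℕ) (j : τ) : wExp0 c c' e β (Sum.inl j) = 0 := by
  simp [wExp0]

omit [Field K] [DecidableEq τ] in
/-- Values of `f₀(β)` on the second variables of the pairs. [cite: Kloosterman2025, Example 4.2] -/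
@[simp] theorem wExp0_inr (β : τ → ℕ) (j : τ) : wExp0 c c' e β (Sum.inr j) = pairProfile c c' e β j := by
  simp [wExp0]

omit [Field K] in
/-- Values of `f₁(β)` on the first variables of the pairs. [cite: Kloosterman2025, Example 4.2] -/
@[simp] theorem wExp1_inl (j0 : τ) (β : τ → ℕ) (j : τ) :
    wExp1 c c' e j0 β (Sum.inl j) = if j = j0 then 1 else 0 := by
  simp [wExp1]

omit [Field K] in
/-- Values of `f₁(β)` on the second variables of the pairs. [cite: Kloosterman2025, Example 4.2] -/
@[simp] theorem wExp1_inr (j0 : τ) (β : τ → ℕ) (j : τ) :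
    wExp1 c c' e j0 β (Sum.inr j) = if j = j0 then e - 2 else pairProfile c c' e β j := by
  simp [wExp1]

omit [Field K] in
/-- The pair sums of `f₁(β)` are those of `f₀(β)` (`1 + (e−2) = e − 1` on the pair `j₀ ∈ D`; `e ≥ 2`).
[cite: Kloosterman2025, Example 4.2] -/
theorem wExp1_pairSum (he : 2 ≤ e) {j0 : τ} (hj0 : c j0 ≠ c' j0) (β : τ → ℕ) (j : τ) :
    wExp1 c c' e j0 β (Sum.inl j) + wExp1 c c' e j0 β (Sum.inr j) = pairProfile c c' e β j := by
  simp only [wExp1_inl, wExp1_inr]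
  by_cases h : j = j0
  · subst h
    rw [if_pos rfl, if_pos rfl, pairProfile, if_neg hj0]
    omega
  · rw [if_neg h, if_neg h, zero_add]

omit [Field K] [DecidableEq τ] in
/-- `|f₀(β)| = Σ_j pairProfile β j`. [cite: Kloosterman2025, Example 4.2] -/
theorem sum_wExp0 (β : τ → ℕ) : ∑ i, wExp0 c c' e β i = ∑ j, pairProfile c c' e β j := by
  rw [sum_eq_sum_pairs]
  simp

omit [Field K] in
/-- `|f₁(β)| = Σ_j pairProfile β j`. [cite: Kloosterman2025, Example 4.2] -/
theorem sum_wExp1 (he : 2 ≤ e) {j0 : τ} (hj0 : c j0 ≠ c' j0) (β : τ → ℕ) :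
    ∑ i, wExp1 c c' e j0 β i = ∑ j, pairProfile c c' e β j := by
  rw [sum_eq_sum_pairs]
  exact Finset.sum_congr rfl fun j _ => wExp1_pairSum c c' e he hj0 β j

omit [Field K] in
/-- For `β ∈ box_E(k)`: `Σ_j pairProfile β j = k + #D·(e−1)` — the degree of the witnesses.
[cite: Kloosterman2025, Example 4.2] -/
theorem sum_pairProfile_of_mem_box {k : ℕ} {β : τ →₀ ℕ} (hβ : β ∈ box (agreePairs c c') e k) :
    ∑ j, pairProfile c c' e ⇑β j = k + (diffPairs c c').card * (e - 1) := by
  simp only [pairProfile]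
  rw [Finset.sum_ite, Finset.sum_const, smul_eq_mul]
  change ∑ x ∈ agreePairs c c', β x + (diffPairs c c').card * (e - 1) = _
  rw [sum_eq_of_mem_box hβ]

/-- `ℓ_t(x^{f₀(β)}·x^m)` for any twist vector `t`: `∏_j t_j^{m(2j)}` if every pair sum `pairProfile β j + m_j` is
`e − 1`, else `0`. [cite: Kloosterman2025, Example 4.2] [cite: MovasatiVillaflor2018, Theorem 1] -/
theorem apply_wExp0_mul (t : τ → K) (β : τ → ℕ) (m : τ ⊕ τ →₀ ℕ) :
    fermatLinearCycleFunctional t e (monomial (wExp0 c c' e β) 1 * monomial m 1) =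
      if ∀ j, pairProfile c c' e β j + (m (Sum.inl j) + m (Sum.inr j)) = e - 1 then
        ∏ j, t j ^ m (Sum.inl j) else 0 := by
  rw [fermatLinearCycleFunctional_monomial_mul_monomial]
  simp only [wExp0_inl, wExp0_inr, zero_add]

/-- `ℓ_t(x^{f₁(β)}·x^m) = t_{j₀} · ℓ_t(x^{f₀(β)}·x^m)`. [cite: Kloosterman2025, Example 4.2]
[cite: MovasatiVillaflor2018, Theorem 1] -/
theorem apply_wExp1_mul (he : 2 ≤ e) {j0 : τ} (hj0 : c j0 ≠ c' j0) (t : τ → K) (β : τ → ℕ)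
    (m : τ ⊕ τ →₀ ℕ) :
    fermatLinearCycleFunctional t e (monomial (wExp1 c c' e j0 β) 1 * monomial m 1) =
      if ∀ j, pairProfile c c' e β j + (m (Sum.inl j) + m (Sum.inr j)) = e - 1 then
        t j0 * ∏ j, t j ^ m (Sum.inl j) else 0 := by
  rw [fermatLinearCycleFunctional_monomial_mul_monomial]
  simp only [wExp1_pairSum c c' e he hj0]
  simp only [wExp1_inl]
  have hprod : ∏ j, t j ^ ((if j = j0 then 1 else 0) + m (Sum.inl j)) = t j0 * ∏ j, t j ^ m (Sum.inl j) := by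
    have hj : ∀ j, t j ^ ((if j = j0 then 1 else 0) + m (Sum.inl j)) =
        (if j = j0 then t j else 1) * t j ^ m (Sum.inl j) := by
      intro j
      split_ifs <;> simp [pow_add]
    rw [Finset.prod_congr rfl fun j _ => hj j, Finset.prod_mul_distrib, Finset.prod_ite_eq']
    simp
  rw [hprod]

omit [DecidableEq τ] in
/-- On a monomial `x^m` meeting the pair-sum condition, the two twist products agree: `m(2j) = 0` on every
differing pair, and `c_j = c'_j` on the common ones. [cite: Kloosterman2025, Example 4.2] -/
theorem prod_pow_eq_of_profile {β : τ → ℕ} {m : τ ⊕ τ →₀ ℕ}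
    (h : ∀ j, pairProfile c c' e β j + (m (Sum.inl j) + m (Sum.inr j)) = e - 1) :
    ∏ j, c j ^ m (Sum.inl j) = ∏ j, c' j ^ m (Sum.inl j) := by
  refine Finset.prod_congr rfl fun j _ => ?_
  by_cases hj : c j = c' j
  · rw [hj]
  · have hj' := h j
    rw [pairProfile, if_neg hj] at hj'
    have hm : m (Sum.inl j) = 0 := by omega
    rw [hm, pow_zero, pow_zero]

/-- **The witness** `g_β = (1+w)·x^{f₁(β)} − (c_{j₀} + w c'_{j₀})·x^{f₀(β)}` (Kloosterman's `λNM₂ − NM₁` for the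
pencil member `ℓ_c + w ℓ_{c'}`). [cite: Kloosterman2025, Example 4.2] [cite: Villaflor2022PeriodsCI, Proposition 1 (proof)] -/
def witness (w : K) (j0 : τ) (β : τ → ℕ) : MvPolynomial (τ ⊕ τ) K :=
  (1 + w) • monomial (wExp1 c c' e j0 β) 1 - (c j0 + w * c' j0) • monomial (wExp0 c c' e β) 1

/-- `g_β · x^m` expanded. [cite: Kloosterman2025, Example 4.2] -/
theorem witness_mul_monomial (w : K) (j0 : τ) (β : τ → ℕ) (m : τ ⊕ τ →₀ ℕ) :
    witness c c' e w j0 β * monomial m 1 =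
      (1 + w) • (monomial (wExp1 c c' e j0 β) 1 * monomial m 1) -
        (c j0 + w * c' j0) • (monomial (wExp0 c c' e β) 1 * monomial m 1) := by
  rw [witness, sub_mul, smul_mul_assoc, smul_mul_assoc]

/-- **The witnesses lie in `Ann(ℓ_c + w ℓ_{c'})`**: on a monomial `x^m` meeting the pair-sum condition both
`x^{f₀(β)}x^m` and `x^{f₁(β)}x^m` evaluate to `π, c_{j₀}π` under `ℓ_c` and `π, c'_{j₀}π` under `ℓ_{c'}` with the SAME
`π = ∏_{j ∈ E} c_j^{m(2j)}`, and `(1+w)(c_{j₀} + wc'_{j₀})π − (c_{j₀} + wc'_{j₀})(1+w)π = 0` ("`σ(N'(λNM₂ − NM₁)) = 0`").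
[cite: Kloosterman2025, Example 4.2] [cite: Villaflor2022PeriodsCI, Proposition 1 (proof)] -/
theorem witness_mem_annIdeal (he : 2 ≤ e) (w : K) {j0 : τ} (hj0 : c j0 ≠ c' j0) (β : τ → ℕ) :
    witness c c' e w j0 β ∈
      annIdeal (fermatLinearCycleFunctional c e + w • fermatLinearCycleFunctional c' e) := by
  rw [mem_annIdeal_iff_forall_monomial]
  intro m
  rw [witness_mul_monomial, map_sub, map_smul, map_smul, LinearMap.add_apply, LinearMap.add_apply,
    LinearMap.smul_apply, LinearMap.smul_apply, apply_wExp1_mul c c' e he hj0 c,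
    apply_wExp1_mul c c' e he hj0 c', apply_wExp0_mul c c' e c, apply_wExp0_mul c c' e c']
  by_cases h : ∀ j, pairProfile c c' e β j + (m (Sum.inl j) + m (Sum.inr j)) = e - 1
  · simp only [if_pos h, prod_pow_eq_of_profile c c' e h, smul_eq_mul]
    ring
  · simp only [if_neg h, smul_zero, add_zero, sub_self]

/-- The TEST monomial `x^{m*(β₀)} = ∏_{j ∈ E} x_{2j+1}^{e−1−β₀_j}` dual to the witness `g_{β₀}`.
[cite: Kloosterman2025, Example 4.2] -/
def testExp (β0 : τ → ℕ) : τ ⊕ τ →₀ ℕ :=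
  Finsupp.equivFunOnFinite.symm (Sum.elim (fun _ => 0) fun j => if c j = c' j then e - 1 - β0 j else 0)

omit [Field K] [DecidableEq τ] in
/-- Values of the test exponent on the first variables. [cite: Kloosterman2025, Example 4.2] -/
@[simp] theorem testExp_inl (β0 : τ → ℕ) (j : τ) : testExp c c' e β0 (Sum.inl j) = 0 := by
  simp [testExp]

omit [Field K] [DecidableEq τ] in
/-- Values of the test exponent on the second variables. [cite: Kloosterman2025, Example 4.2] -/
@[simp] theorem testExp_inr (β0 : τ → ℕ) (j : τ) :
    testExp c c' e β0 (Sum.inr j) = if c j = c' j then e - 1 - β0 j else 0 := by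
  simp [testExp]

omit [Field K] [DecidableEq τ] in
/-- The pair-sum condition for `x^{f(β)} · x^{m*(β₀)}` holds iff `β = β₀` (for `β, β₀` supported on `E`,
`β₀ ≤ e − 1`). [cite: Kloosterman2025, Example 4.2] -/
theorem profile_add_testExp_iff {β β0 : τ → ℕ} (hβ : ∀ j, c j ≠ c' j → β j = 0)
    (hβ0 : ∀ j, c j ≠ c' j → β0 j = 0) (hβ0le : ∀ j, β0 j ≤ e - 1) :
    (∀ j, pairProfile c c' e β j + (testExp c c' e β0 (Sum.inl j) + testExp c c' e β0 (Sum.inr j)) = e - 1) ↔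
      β = β0 := by
  simp only [testExp_inl, testExp_inr, zero_add, pairProfile]
  constructor
  · intro h
    funext j
    by_cases hj : c j = c' j
    · have h1 := h j
      rw [if_pos hj, if_pos hj] at h1
      have h2 := hβ0le j
      omega
    · rw [hβ j hj, hβ0 j hj]
  · rintro rfl j
    by_cases hj : c j = c' j
    · rw [if_pos hj, if_pos hj]
      have h2 := hβ0le j
      omega
    · rw [if_neg hj, if_neg hj]
      omega

/-- **`ℓ_c(g_β · x^{m*(β₀)}) = [β = β₀]·w·(c_{j₀} − c'_{j₀})`**: the test monomial sees exactly one witness, with a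
NON-ZERO value for `w ≠ 0`, `c_{j₀} ≠ c'_{j₀}` (Villaflor: "Since `β₁ ≠ β₂`, this implies …").
[cite: Villaflor2022PeriodsCI, Proposition 1 (proof)] [cite: Kloosterman2025, Example 4.2] -/
theorem apply_witness_mul_testExp (he : 2 ≤ e) (w : K) {j0 : τ} (hj0 : c j0 ≠ c' j0) {β β0 : τ → ℕ}
    (hβ : ∀ j, c j ≠ c' j → β j = 0) (hβ0 : ∀ j, c j ≠ c' j → β0 j = 0) (hβ0le : ∀ j, β0 j ≤ e - 1) :
    fermatLinearCycleFunctional c e (witness c c' e w j0 β * monomial (testExp c c' e β0) 1) =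
      if β = β0 then w * (c j0 - c' j0) else 0 := by
  rw [witness_mul_monomial, map_sub, map_smul, map_smul, apply_wExp1_mul c c' e he hj0 c,
    apply_wExp0_mul c c' e c]
  have hπ : ∏ j, c j ^ testExp c c' e β0 (Sum.inl j) = 1 := by simp
  rw [hπ, mul_one]
  by_cases hb : β = β0
  · have hcond := (profile_add_testExp_iff c c' e hβ hβ0 hβ0le).mpr hb
    rw [if_pos hcond, if_pos hcond, if_pos hb, smul_eq_mul, smul_eq_mul]
    ring
  · have hcond : ¬ ∀ j, pairProfile c c' e β j +
        (testExp c c' e β0 (Sum.inl j) + testExp c c' e β0 (Sum.inr j)) = e - 1 :=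
      fun h => hb ((profile_add_testExp_iff c c' e hβ hβ0 hβ0le).mp h)
    rw [if_neg hcond, if_neg hcond, if_neg hb, smul_zero, smul_zero, sub_zero]

omit [Field K] in
/-- Box elements are supported on `E`. [cite: Kloosterman2025, Proposition 4.1] -/
theorem eq_zero_of_mem_box {k : ℕ} {β : τ →₀ ℕ} (hβ : β ∈ box (agreePairs c c') e k) (j : τ)
    (hj : c j ≠ c' j) : β j = 0 :=
  (mem_box.mp hβ).2.2 j fun h => hj ((mem_agreePairs c c').mp h)

/-- **Linear independence of the witnesses modulo `Ann(ℓ_c)`**: if `Σ_β a_β g_β ∈ Ann(ℓ_c)` (sum over `box_E(k)`)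
then every `a_β = 0` — test against `x^{m*(β₀)}`. [cite: Villaflor2022PeriodsCI, Proposition 1 (proof)]
[cite: Kloosterman2025, Example 4.2] -/
theorem eq_zero_of_sum_smul_witness_mem (he : 2 ≤ e) {w : K} (hw : w ≠ 0) {j0 : τ} (hj0 : c j0 ≠ c' j0)
    {k : ℕ} (a : (τ →₀ ℕ) → K)
    (h : ∑ β ∈ box (agreePairs c c') e k, a β • witness c c' e w j0 ⇑β ∈
      annIdeal (fermatLinearCycleFunctional c e)) :
    ∀ β ∈ box (agreePairs c c') e k, a β = 0 := by
  intro β0 hβ0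
  obtain ⟨-, hβ0le, -⟩ := mem_box.mp hβ0
  have H := (mem_annIdeal_iff_forall_monomial _ _).mp h (testExp c c' e ⇑β0)
  rw [Finset.sum_mul, map_sum] at H
  have H' : ∑ β ∈ box (agreePairs c c') e k,
      a β * (if (⇑β : τ → ℕ) = ⇑β0 then w * (c j0 - c' j0) else 0) = 0 := by
    refine Eq.trans (Finset.sum_congr rfl fun β hβ => ?_) H
    rw [smul_mul_assoc, map_smul, smul_eq_mul, apply_witness_mul_testExp c c' e he w hj0
      (eq_zero_of_mem_box c c' e hβ) (eq_zero_of_mem_box c c' e hβ0) hβ0le]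
  rw [Finset.sum_eq_single β0 (fun β _ hne => by
      rw [if_neg (fun hh => hne (DFunLike.coe_injective hh)), mul_zero]) (fun hn => absurd hβ0 hn),
    if_pos rfl] at H'
  exact (mul_eq_zero.mp H').resolve_right (mul_ne_zero hw (sub_ne_zero.mpr hj0))

/-- The witnesses are homogeneous of degree `k + #D·(e−1)`. [cite: Kloosterman2025, Example 4.2] -/
theorem isHomogeneous_witness (he : 2 ≤ e) {j0 : τ} (hj0 : c j0 ≠ c' j0) (w : K) {k : ℕ} {β : τ →₀ ℕ}
    (hβ : β ∈ box (agreePairs c c') e k) :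
    (witness c c' e w j0 ⇑β).IsHomogeneous (k + (diffPairs c c').card * (e - 1)) := by
  have h0 : (monomial (wExp0 c c' e ⇑β) (1 : K)).IsHomogeneous (k + (diffPairs c c').card * (e - 1)) := by
    have h := isHomogeneous_monomial_sum (K := K) (wExp0 c c' e ⇑β)
    rwa [sum_wExp0, sum_pairProfile_of_mem_box c c' e hβ] at h
  have h1 : (monomial (wExp1 c c' e j0 ⇑β) (1 : K)).IsHomogeneous (k + (diffPairs c c').card * (e - 1)) := by
    have h := isHomogeneous_monomial_sum (K := K) (wExp1 c c' e j0 ⇑β)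
    rwa [sum_wExp1 c c' e he hj0, sum_pairProfile_of_mem_box c c' e hβ] at h
  rw [witness]
  exact (mem_homogeneousSubmodule _ _).mp (Submodule.sub_mem _
    (Submodule.smul_mem _ _ ((mem_homogeneousSubmodule _ _).mpr h1))
    (Submodule.smul_mem _ _ ((mem_homogeneousSubmodule _ _).mpr h0)))

/-- The span of the witnesses `g_β`, `β ∈ box_E(k)`. [cite: Kloosterman2025, Example 4.2] -/
def witnessSpan (w : K) (j0 : τ) (k : ℕ) : Submodule K (MvPolynomial (τ ⊕ τ) K) :=
  Submodule.span K (Set.range fun β : ↥(box (agreePairs c c') e k) => witness c c' e w j0 ⇑β.1)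

/-- The witness span is finite-dimensional. [cite: Kloosterman2025, Example 4.2] -/
instance witnessSpan.finite (w : K) (j0 : τ) (k : ℕ) : Module.Finite K (witnessSpan c c' e w j0 k) :=
  Module.Finite.span_of_finite K (Set.finite_range _)

/-- The witness span lies in `Ann(ℓ_c + wℓ_{c'})_{k + #D(e−1)}`. [cite: Kloosterman2025, Example 4.2] -/
theorem witnessSpan_le (he : 2 ≤ e) (w : K) {j0 : τ} (hj0 : c j0 ≠ c' j0) (k : ℕ) :
    witnessSpan c c' e w j0 k ≤
      idealDegree (annIdeal (fermatLinearCycleFunctional c e + w • fermatLinearCycleFunctional c' e))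
        (k + (diffPairs c c').card * (e - 1)) := by
  refine Submodule.span_le.mpr ?_
  rintro _ ⟨β, rfl⟩
  exact ⟨witness_mem_annIdeal c c' e he w hj0 ⇑β.1, isHomogeneous_witness c c' e he hj0 w β.2⟩

/-- A sum over the subtype of the box is a sum over the box with extended coefficients. [folklore] -/
private theorem sum_coe_box_eq (w : K) (j0 : τ) (k : ℕ) (g : ↥(box (agreePairs c c') e k) → K) :
    ∑ i : ↥(box (agreePairs c c') e k), g i • witness c c' e w j0 ⇑i.1 =
      ∑ β ∈ box (agreePairs c c') e k,
        (fun β => if h : β ∈ box (agreePairs c c') e k then g ⟨β, h⟩ else 0) β • witness c c' e w j0 ⇑β := by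
  rw [← Finset.sum_coe_sort (box (agreePairs c c') e k)]
  refine Finset.sum_congr rfl fun i _ => ?_
  simp only [dif_pos i.2]

/-- **The witnesses are linearly independent.** [cite: Kloosterman2025, Example 4.2] -/
theorem linearIndependent_witness (he : 2 ≤ e) {w : K} (hw : w ≠ 0) {j0 : τ} (hj0 : c j0 ≠ c' j0) (k : ℕ) :
    LinearIndependent K (fun β : ↥(box (agreePairs c c') e k) => witness c c' e w j0 ⇑β.1) := by
  rw [Fintype.linearIndependent_iff]
  intro g hg i
  rw [sum_coe_box_eq] at hg
  have ha := eq_zero_of_sum_smul_witness_mem c c' e he hw hj0 _ (by rw [hg]; exact Submodule.zero_mem _)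
  have := ha i.1 i.2
  simp only [dif_pos i.2] at this
  exact this

/-- `dim span{g_β} = box_E(k)`. [cite: Kloosterman2025, Example 4.2] -/
theorem finrank_witnessSpan (he : 2 ≤ e) {w : K} (hw : w ≠ 0) {j0 : τ} (hj0 : c j0 ≠ c' j0) (k : ℕ) :
    finrank K (witnessSpan c c' e w j0 k) = (box (agreePairs c c') e k).card := by
  rw [witnessSpan, finrank_span_eq_card (linearIndependent_witness c c' e he hw hj0 k), Fintype.card_coe]

/-- **The witness span meets `Ann(ℓ_c)` trivially** (independence modulo `Ann ℓ_c`, a fortiori modulo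
`Ann ℓ_c ∩ Ann ℓ_{c'}`). [cite: Villaflor2022PeriodsCI, Proposition 1 (proof)] [cite: Kloosterman2025, Example 4.2] -/
theorem eq_zero_of_mem_witnessSpan (he : 2 ≤ e) {w : K} (hw : w ≠ 0) {j0 : τ} (hj0 : c j0 ≠ c' j0) {k : ℕ}
    {x : MvPolynomial (τ ⊕ τ) K} (hx : x ∈ witnessSpan c c' e w j0 k)
    (hx' : x ∈ annIdeal (fermatLinearCycleFunctional c e)) : x = 0 := by
  obtain ⟨g, rfl⟩ := (Submodule.mem_span_range_iff_exists_fun K).mp hx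
  rw [sum_coe_box_eq] at hx' ⊢
  have ha := eq_zero_of_sum_smul_witness_mem c c' e he hw hj0 _ hx'
  exact Finset.sum_eq_zero fun β hβ => by simp only [ha β hβ, zero_smul]

/-- **Lower bound** (the `≥` half of the main theorem): `box_E(k) + dim (Ann ℓ_c ∩ Ann ℓ_{c'})_a ≤ dim Ann(ℓ_c + wℓ_{c'})_a`
for `a = k + #D(e−1)`, `w ≠ 0`, `e ≥ 2` (`d ≥ 3`), `c ≠ c'` — Villaflor's "only if" for every degree between
`(d−2)(n/2−m)` and the socle, with the multiplicity made exact. [cite: Villaflor2022PeriodsCI, Theorem 3 (proof)]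
[cite: Kloosterman2025, Example 4.2] -/
theorem card_box_add_finrank_le (he : 2 ≤ e) {w : K} (hw : w ≠ 0) {j0 : τ} (hj0 : c j0 ≠ c' j0) (k : ℕ) :
    (box (agreePairs c c') e k).card +
        finrank K (idealDegree (annIdeal (fermatLinearCycleFunctional c e) ⊓
          annIdeal (fermatLinearCycleFunctional c' e)) (k + (diffPairs c c').card * (e - 1))) ≤
      finrank K (idealDegree
        (annIdeal (fermatLinearCycleFunctional c e + w • fermatLinearCycleFunctional c' e))
        (k + (diffPairs c c').card * (e - 1))) := by
  have hG := witnessSpan_le c c' e he w hj0 k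
  have hM : idealDegree (annIdeal (fermatLinearCycleFunctional c e) ⊓
      annIdeal (fermatLinearCycleFunctional c' e)) (k + (diffPairs c c').card * (e - 1)) ≤
      idealDegree (annIdeal (fermatLinearCycleFunctional c e + w • fermatLinearCycleFunctional c' e))
        (k + (diffPairs c c').card * (e - 1)) :=
    idealDegree_mono (inf_annIdeal_le_annIdeal_add_smul _ _ w) _
  have hdisj : witnessSpan c c' e w j0 k ⊓ idealDegree (annIdeal (fermatLinearCycleFunctional c e) ⊓
      annIdeal (fermatLinearCycleFunctional c' e)) (k + (diffPairs c c').card * (e - 1)) = ⊥ := by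
    refine eq_bot_iff.mpr fun x hx => ?_
    rw [Submodule.mem_bot]
    exact eq_zero_of_mem_witnessSpan c c' e he hw hj0 hx.1 hx.2.1.1
  have h1 := Submodule.finrank_mono (sup_le hG hM)
  have h2 := Submodule.finrank_sup_add_finrank_inf_eq (witnessSpan c c' e w j0 k)
    (idealDegree (annIdeal (fermatLinearCycleFunctional c e) ⊓
      annIdeal (fermatLinearCycleFunctional c' e)) (k + (diffPairs c c').card * (e - 1)))
  rw [hdisj, finrank_bot, add_zero, finrank_witnessSpan c c' e he hw hj0 k] at h2
  omega


/-! ## The main theorem: the excess is `h_{Ann ℓ_c + Ann ℓ_{c'}}(σ₀ − a) = box_E(σ₀ − a)` -/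

omit [Field K] [DecidableEq τ] in
/-- `#τ·(e−1) = #E·(e−1) + #D·(e−1)` (`σ₀ = (m+1)(d−2) + (n/2−m)(d−2)`). [cite: Villaflor2022PeriodsCI, Theorem 3 (proof)] -/
theorem socle_eq_card_mul_add :
    Fintype.card τ * (e - 1) = (agreePairs c c').card * (e - 1) + (diffPairs c c').card * (e - 1) := by
  rw [← card_agreePairs_add_card_diffPairs c c', add_mul]

/-- **MAIN THEOREM (the exact excess).** For `e = d − 1 ≥ 2`, two DISTINCT twist vectors `c ≠ c'` (common pairs
`E`, `σ₀ = #τ·(e−1)`), `w ≠ 0` and `a ≤ σ₀`: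
`dim_K Ann(ℓ_c + wℓ_{c'})_a − dim_K (Ann ℓ_c ∩ Ann ℓ_{c'})_a = box_E(σ₀ − a)` AND `h_{Ann ℓ_c + Ann ℓ_{c'}}(σ₀ − a) = box_E(σ₀ − a)`
— Kloosterman's bound `e(λ) ≤ h_{I₁+I₂}(kd−2k−2)` (Lemma 2.9 / 3.12, here in every degree) is ATTAINED at the Fermat
pair for every `λ`, and `h_{I₁+I₂}` is the Hilbert function of `K[y_j : j ∈ E]/(y_j^{d−1})` (Prop. 4.1:
`I₁ + I₂ = ⟨y_0,…,y_{2c−1}, y_{2c}^{d−1},…,y_{k+c}^{d−1}, y_{k+c+1},…⟩`; the printed values `1` and `k+1−c` for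
`(c−1)(d−2) = 2, 1` at `a = d`). Villaflor's claim (proof of Thm. 3) is the statement that this number vanishes iff
`a < (d−2)(n/2−m)` (or `a > σ₀`): `idealDegree_inf_eq_annIdeal_add_smul_iff` below.
[cite: Villaflor2022PeriodsCI, Theorem 3 (proof)] [cite: Kloosterman2025, Lemma 3.12, Proposition 4.1, Example 4.2] -/
theorem excess_eq_card_box (he : 2 ≤ e) (hcc' : c ≠ c') {w : K} (hw : w ≠ 0) {a : ℕ}
    (ha : a ≤ Fintype.card τ * (e - 1)) :
    finrank K (idealDegree
          (annIdeal (fermatLinearCycleFunctional c e + w • fermatLinearCycleFunctional c' e)) a) -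
        finrank K (idealDegree (annIdeal (fermatLinearCycleFunctional c e) ⊓
          annIdeal (fermatLinearCycleFunctional c' e)) a) =
      (box (agreePairs c c') e (Fintype.card τ * (e - 1) - a)).card ∧
    finrank K (homogeneousSubmodule (τ ⊕ τ) K (Fintype.card τ * (e - 1) - a)) -
        finrank K (idealDegree (annIdeal (fermatLinearCycleFunctional c e) ⊔
          annIdeal (fermatLinearCycleFunctional c' e)) (Fintype.card τ * (e - 1) - a)) =
      (box (agreePairs c c') e (Fintype.card τ * (e - 1) - a)).card := by
  obtain ⟨j0, hj0⟩ : ∃ j0, c j0 ≠ c' j0 := by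
    by_contra h
    push Not at h
    exact hcc' (funext h)
  have hσ := socle_eq_card_mul_add c c' e
  have hconc := fermatLinearCycleFunctional_homogeneousComponent c e
  have hconc' := fermatLinearCycleFunctional_homogeneousComponent c' e
  -- Kloosterman's upper bound and the spanning bound
  have hup := excess_le_hilbert_sup' hconc hconc' (a := a) (b := Fintype.card τ * (e - 1) - a) (by omega) hw
  have hup2 := hilbert_sup_annIdeal_le_card_box c c' e (by omega) (Fintype.card τ * (e - 1) - a)
  -- the intersection lies in the pencil member
  have hmono := Submodule.finrank_mono (idealDegree_mono (inf_annIdeal_le_annIdeal_add_smul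
    (fermatLinearCycleFunctional c e) (fermatLinearCycleFunctional c' e) w) a)
  by_cases hlt : a < (diffPairs c c').card * (e - 1)
  · -- below `(d−2)(n/2−m)`: the box is empty
    have hempty : box (agreePairs c c') e (Fintype.card τ * (e - 1) - a) = ∅ :=
      box_eq_empty_of_lt (by omega)
    rw [hempty, Finset.card_empty] at hup2 ⊢
    omega
  · -- between `(d−2)(n/2−m)` and the socle: squeeze with the witnesses and the symmetry of the box
    push Not at hlt
    have hak : a = (a - (diffPairs c c').card * (e - 1)) + (diffPairs c c').card * (e - 1) := by omega
    have hlow := card_box_add_finrank_le c c' e he hw hj0 (a - (diffPairs c c').card * (e - 1))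
    rw [← hak] at hlow
    have hkE : a - (diffPairs c c').card * (e - 1) ≤ (agreePairs c c').card * (e - 1) := by omega
    have hsymm := card_box_symm (E := agreePairs c c') (e := e) hkE
    rw [show (agreePairs c c').card * (e - 1) - (a - (diffPairs c c').card * (e - 1)) =
      Fintype.card τ * (e - 1) - a by omega] at hsymm
    omega

/-- **The excess alone**: `dim Ann(ℓ_c + wℓ_{c'})_a − dim (Ann ℓ_c ∩ Ann ℓ_{c'})_a = box_E(σ₀ − a)` (`a ≤ σ₀`).
[cite: Villaflor2022PeriodsCI, Theorem 3 (proof)] [cite: Kloosterman2025, Example 4.2] -/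
theorem finrank_sub_finrank_eq_card_box (he : 2 ≤ e) (hcc' : c ≠ c') {w : K} (hw : w ≠ 0) {a : ℕ}
    (ha : a ≤ Fintype.card τ * (e - 1)) :
    finrank K (idealDegree
          (annIdeal (fermatLinearCycleFunctional c e + w • fermatLinearCycleFunctional c' e)) a) -
        finrank K (idealDegree (annIdeal (fermatLinearCycleFunctional c e) ⊓
          annIdeal (fermatLinearCycleFunctional c' e)) a) =
      (box (agreePairs c c') e (Fintype.card τ * (e - 1) - a)).card :=
  (excess_eq_card_box c c' e he hcc' hw ha).1

/-- **`h_{Ann ℓ_c + Ann ℓ_{c'}} = box_E` in EVERY degree**: the Hilbert function of `Ann ℓ_c + Ann ℓ_{c'}` is that of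
`K[y_j : j ∈ E]/(y_j^e)` (`= ciHilbert [e,…,e]`, `#E = m+1` entries) — Kloosterman's `I₁ + I₂` at the Fermat pair.
[cite: Kloosterman2025, Proposition 4.1] [cite: Villaflor2022PeriodsCI, Theorem 3 (proof)] -/
theorem hilbert_sup_annIdeal_eq_card_box (he : 2 ≤ e) (hcc' : c ≠ c') (b : ℕ) :
    finrank K (homogeneousSubmodule (τ ⊕ τ) K b) -
        finrank K (idealDegree (annIdeal (fermatLinearCycleFunctional c e) ⊔
          annIdeal (fermatLinearCycleFunctional c' e)) b) = (box (agreePairs c c') e b).card := by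
  by_cases hb : b ≤ Fintype.card τ * (e - 1)
  · have h := (excess_eq_card_box c c' e he hcc' (one_ne_zero (α := K))
      (a := Fintype.card τ * (e - 1) - b) (Nat.sub_le _ _)).2
    rwa [Nat.sub_sub_self hb] at h
  · push Not at hb
    have hσ := socle_eq_card_mul_add c c' e
    have h1 := hilbert_sup_annIdeal_le_card_box c c' e (by omega) b
    have hempty : box (agreePairs c c') e b = ∅ := box_eq_empty_of_lt (by omega)
    rw [hempty, Finset.card_empty] at h1 ⊢
    omega

/-- … and as a `ciHilbert` value: `h_{Ann ℓ_c + Ann ℓ_{c'}}(b) = ciHilbert [e, …, e] (#E entries) b`.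
[cite: Kloosterman2025, Proposition 4.1] [cite: Kloosterman2023, §2 eq. (1)] -/
theorem hilbert_sup_annIdeal_eq_ciHilbert (he : 2 ≤ e) (hcc' : c ≠ c') (b : ℕ) :
    finrank K (homogeneousSubmodule (τ ⊕ τ) K b) -
        finrank K (idealDegree (annIdeal (fermatLinearCycleFunctional c e) ⊔
          annIdeal (fermatLinearCycleFunctional c' e)) b) =
      Kloosterman2023.ciHilbert (List.replicate (agreePairs c c').card e) b := by
  rw [hilbert_sup_annIdeal_eq_card_box c c' e he hcc' b, card_box_eq_ciHilbert _ (by omega)]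

/-- **Villaflor's claim (proof of Thm. 3), for every pair of distinct twist vectors and every `w ≠ 0`:**
`(Ann ℓ_c)_a ∩ (Ann ℓ_{c'})_a = Ann(ℓ_c + wℓ_{c'})_a ⟺ a < #D·(e−1) ∨ a > #τ·(e−1)`, i.e. (with `e = d − 1`,
`#D = n/2 − m`, `#τ = n/2 + 1`) "`(J^F:P₁)_e ∩ (J^F:P₂)_e = (J^F:P₁+P₂)_e` if and only if `e < (d−2)(n/2−m)` or
`e > (d−2)(n/2+1)`". [cite: Villaflor2022PeriodsCI, Theorem 3 (proof), Remark 7] -/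
theorem idealDegree_inf_eq_annIdeal_add_smul_iff (he : 2 ≤ e) (hcc' : c ≠ c') {w : K} (hw : w ≠ 0) (a : ℕ) :
    idealDegree (annIdeal (fermatLinearCycleFunctional c e) ⊓ annIdeal (fermatLinearCycleFunctional c' e)) a =
        idealDegree (annIdeal (fermatLinearCycleFunctional c e + w • fermatLinearCycleFunctional c' e)) a ↔
      a < (diffPairs c c').card * (e - 1) ∨ Fintype.card τ * (e - 1) < a := by
  have hσ := socle_eq_card_mul_add c c' e
  have hconc := fermatLinearCycleFunctional_homogeneousComponent c e
  have hconc' := fermatLinearCycleFunctional_homogeneousComponent c' e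
  have hle : idealDegree (annIdeal (fermatLinearCycleFunctional c e) ⊓
      annIdeal (fermatLinearCycleFunctional c' e)) a ≤
      idealDegree (annIdeal (fermatLinearCycleFunctional c e + w • fermatLinearCycleFunctional c' e)) a :=
    idealDegree_mono (inf_annIdeal_le_annIdeal_add_smul _ _ w) a
  have hmono := Submodule.finrank_mono hle
  -- equality of the two pieces is the vanishing of the excess
  have key : idealDegree (annIdeal (fermatLinearCycleFunctional c e) ⊓
        annIdeal (fermatLinearCycleFunctional c' e)) a =
        idealDegree (annIdeal (fermatLinearCycleFunctional c e + w • fermatLinearCycleFunctional c' e)) a ↔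
      finrank K (idealDegree
          (annIdeal (fermatLinearCycleFunctional c e + w • fermatLinearCycleFunctional c' e)) a) -
        finrank K (idealDegree (annIdeal (fermatLinearCycleFunctional c e) ⊓
          annIdeal (fermatLinearCycleFunctional c' e)) a) = 0 := by
    constructor
    · intro h
      rw [h, Nat.sub_self]
    · intro h
      exact Submodule.eq_of_le_of_finrank_le hle (by omega)
  rw [key]
  by_cases ha : a ≤ Fintype.card τ * (e - 1)
  · rw [(excess_eq_card_box c c' e he hcc' hw ha).1]
    have hpos := card_box_pos_iff (agreePairs c c') (e := e) (by omega) (Fintype.card τ * (e - 1) - a)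
    constructor
    · intro h0
      left
      by_contra hge
      have : 0 < (box (agreePairs c c') e (Fintype.card τ * (e - 1) - a)).card := hpos.mpr (by omega)
      omega
    · rintro (h | h)
      · by_contra hne
        have := hpos.mp (Nat.pos_of_ne_zero hne)
        omega
      · omega
  · push Not at ha
    have h1 : idealDegree
        (annIdeal (fermatLinearCycleFunctional c e + w • fermatLinearCycleFunctional c' e)) a =
        homogeneousSubmodule (τ ⊕ τ) K a :=
      idealDegree_annIdeal_eq_of_lt (add_smul_homogeneousComponent hconc hconc' w) ha
    have h2 : idealDegree (annIdeal (fermatLinearCycleFunctional c e) ⊓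
        annIdeal (fermatLinearCycleFunctional c' e)) a = homogeneousSubmodule (τ ⊕ τ) K a := by
      refine le_antisymm (idealDegree_le_homogeneousSubmodule _ _) ?_
      rw [idealDegree_inf, idealDegree_annIdeal_eq_of_lt hconc ha, idealDegree_annIdeal_eq_of_lt hconc' ha]
      exact le_inf le_rfl le_rfl
    rw [h1, h2, Nat.sub_self]
    exact ⟨fun _ => Or.inr ha, fun _ => rfl⟩

/-- **Below the threshold the pieces agree** (Villaflor's "if": `e < (d−2)(n/2−m)`; Kloosterman's Cor. 3.14 /
Lemma 2.9 at the Fermat pair). [cite: Villaflor2022PeriodsCI, Theorem 3 (proof)] [cite: Kloosterman2025, Lemma 2.9] -/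
theorem idealDegree_inf_eq_of_lt (he : 2 ≤ e) (hcc' : c ≠ c') {w : K} (hw : w ≠ 0) {a : ℕ}
    (ha : a < (diffPairs c c').card * (e - 1)) :
    idealDegree (annIdeal (fermatLinearCycleFunctional c e) ⊓ annIdeal (fermatLinearCycleFunctional c' e)) a =
      idealDegree (annIdeal (fermatLinearCycleFunctional c e + w • fermatLinearCycleFunctional c' e)) a :=
  (idealDegree_inf_eq_annIdeal_add_smul_iff c c' e he hcc' hw a).mpr (Or.inl ha)

/-- **From the threshold to the socle they differ** (Villaflor's "only if": `(d−2)(n/2−m) ≤ e ≤ (d−2)(n/2+1)`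
gives a strictly bigger `(J^F : P₁ + P₂)_e`). [cite: Villaflor2022PeriodsCI, Theorem 3 (proof)]
[cite: Kloosterman2025, Example 4.2] -/
theorem idealDegree_inf_ne_of_le (he : 2 ≤ e) (hcc' : c ≠ c') {w : K} (hw : w ≠ 0) {a : ℕ}
    (ha : (diffPairs c c').card * (e - 1) ≤ a) (ha' : a ≤ Fintype.card τ * (e - 1)) :
    idealDegree (annIdeal (fermatLinearCycleFunctional c e) ⊓ annIdeal (fermatLinearCycleFunctional c' e)) a ≠
      idealDegree (annIdeal (fermatLinearCycleFunctional c e + w • fermatLinearCycleFunctional c' e)) a := by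
  intro h
  rcases (idealDegree_inf_eq_annIdeal_add_smul_iff c c' e he hcc' hw a).mp h with h' | h' <;> omega

/-! ## From period functionals to the printed colon ideals `(J : R_i)`, `(J : R₁ + R₂)` -/

omit [DecidableEq τ] [DecidableEq K] in
/-- `(J : a·P_t) = Ann(ℓ_t)` for `J = (x_i^e)`, `a ≠ 0`, `P_t = ∏_j (x_{2j}^e − (t_jx_{2j+1})^e)/(x_{2j} − t_jx_{2j+1})`
(DFV eq. (eqAGfakelcFermat) and the inverse system of the right-hand side).
[cite: DuqueFrancoVillaflor2025Join, Remark 7.1] [cite: Villaflor2022PeriodsCI, Corollary 4] -/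
theorem colon_C_mul_fermatLinearCyclePolynomial_eq_annIdeal (he : 1 ≤ e) {a : K} (ha : a ≠ 0) (t : τ → K) :
    (Ideal.span (Set.range fun i : τ ⊕ τ => (X i : MvPolynomial (τ ⊕ τ) K) ^ e)).colon
        {C a * fermatLinearCyclePolynomial t e} = annIdeal (fermatLinearCycleFunctional t e) := by
  rw [span_X_pow_colon_C_mul_fermatLinearCyclePolynomial t e he ha, annIdeal_fermatLinearCycleFunctional t e he]

omit [DecidableEq τ] [DecidableEq K] in
/-- The functional `g ↦ coeff_{socle}(g · aP_t)` defining `(J : aP_t)` is concentrated in degree `#τ·(e−1)`.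
[cite: DuqueFrancoVillaflor2025Join, Definition 2.2, Remark 7.1] -/
theorem socleFunctional_comp_mulRight_homogeneousComponent (a : K) (t : τ → K)
    (p : MvPolynomial (τ ⊕ τ) K) :
    (fermatSocleFunctional K (τ ⊕ τ) e ∘ₗ LinearMap.mulRight K (C a * fermatLinearCyclePolynomial t e))
        (homogeneousComponent (Fintype.card τ * (e - 1)) p) =
      (fermatSocleFunctional K (τ ⊕ τ) e ∘ₗ LinearMap.mulRight K (C a * fermatLinearCyclePolynomial t e)) p := by
  have hP : (C a * fermatLinearCyclePolynomial t e).IsHomogeneous (Fintype.card τ * (e - 1)) := by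
    have h := (isHomogeneous_C (τ ⊕ τ) a).mul (isHomogeneous_fermatLinearCyclePolynomial t e)
    rwa [zero_add] at h
  refine comp_mulRight_homogeneousComponent (fermatSocleFunctional_homogeneousComponent (K := K)) hP ?_ p
  rw [Fintype.card_sum]
  ring

omit [DecidableEq τ] [DecidableEq K] in
/-- **`(J : a₁P_{t₁} + a₂P_{t₂}) = Ann(ℓ_{t₁} + w ℓ_{t₂})` for some `w ≠ 0`** (`a₁, a₂ ≠ 0`): the colon ideal of the
SUM of the two cycle polynomials is a non-degenerate member of the pencil of the two period functionals (each
`g ↦ coeff_{socle}(g·a_iP_{t_i})` has annihilator `(J : a_iP_{t_i}) = Ann(ℓ_{t_i})`, hence is a non-zero multiple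
of `ℓ_{t_i}` by Macaulay's correspondence, tree `annIdeal_eq_annIdeal_iff_exists_smul`). Villaflor: "for some
`c₁, c₂ ∈ ℂ^×`". [cite: Villaflor2022PeriodsCI, Remark 7, Corollary 4] [cite: DuqueFrancoVillaflor2025Join, Remark 2.1] -/
theorem exists_colon_add_eq_annIdeal [DecidableEq τ] (he : 1 ≤ e) {a₁ a₂ : K} (ha₁ : a₁ ≠ 0) (ha₂ : a₂ ≠ 0) (t₁ t₂ : τ → K) :
    ∃ w : K, w ≠ 0 ∧
      (Ideal.span (Set.range fun i : τ ⊕ τ => (X i : MvPolynomial (τ ⊕ τ) K) ^ e)).colon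
          {C a₁ * fermatLinearCyclePolynomial t₁ e + C a₂ * fermatLinearCyclePolynomial t₂ e} =
        annIdeal (fermatLinearCycleFunctional t₁ e + w • fermatLinearCycleFunctional t₂ e) := by
  have hsum : (Ideal.span (Set.range fun i : τ ⊕ τ => (X i : MvPolynomial (τ ⊕ τ) K) ^ e)).colon
      {C a₁ * fermatLinearCyclePolynomial t₁ e + C a₂ * fermatLinearCyclePolynomial t₂ e} =
      annIdeal (fermatSocleFunctional K (τ ⊕ τ) e ∘ₗ LinearMap.mulRight K (C a₁ * fermatLinearCyclePolynomial t₁ e) +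
        fermatSocleFunctional K (τ ⊕ τ) e ∘ₗ LinearMap.mulRight K (C a₂ * fermatLinearCyclePolynomial t₂ e)) := by
    rw [span_X_pow_colon_eq_annIdeal he]
    congr 1
    refine LinearMap.ext fun g => ?_
    simp only [LinearMap.coe_comp, Function.comp_apply, LinearMap.mulRight_apply, LinearMap.add_apply, mul_add,
      map_add]
  have hann : ∀ {a : K} (_ : a ≠ 0) (t : τ → K),
      annIdeal (fermatSocleFunctional K (τ ⊕ τ) e ∘ₗ LinearMap.mulRight K (C a * fermatLinearCyclePolynomial t e)) =
        annIdeal (fermatLinearCycleFunctional t e) := by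
    intro a ha t
    rw [← span_X_pow_colon_eq_annIdeal he, colon_C_mul_fermatLinearCyclePolynomial_eq_annIdeal e he ha t]
  obtain ⟨κ₁, hκ₁, h₁⟩ := (annIdeal_eq_annIdeal_iff_exists_smul
    (socleFunctional_comp_mulRight_homogeneousComponent e a₁ t₁)
    (fermatLinearCycleFunctional_homogeneousComponent t₁ e) (fermatLinearCycleFunctional_ne_zero t₁ e)).mp
    (hann ha₁ t₁)
  obtain ⟨κ₂, hκ₂, h₂⟩ := (annIdeal_eq_annIdeal_iff_exists_smul
    (socleFunctional_comp_mulRight_homogeneousComponent e a₂ t₂)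
    (fermatLinearCycleFunctional_homogeneousComponent t₂ e) (fermatLinearCycleFunctional_ne_zero t₂ e)).mp
    (hann ha₂ t₂)
  -- `ℓ_{t_i} = κ_i ψ_i`, so `ψ₁ + ψ₂ = κ₁⁻¹ (ℓ_{t₁} + κ₁κ₂⁻¹ ℓ_{t₂})`
  refine ⟨κ₁ * κ₂⁻¹, mul_ne_zero hκ₁ (inv_ne_zero hκ₂), ?_⟩
  rw [hsum]
  have hψ : fermatSocleFunctional K (τ ⊕ τ) e ∘ₗ LinearMap.mulRight K (C a₁ * fermatLinearCyclePolynomial t₁ e) +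
      fermatSocleFunctional K (τ ⊕ τ) e ∘ₗ LinearMap.mulRight K (C a₂ * fermatLinearCyclePolynomial t₂ e) =
      κ₁⁻¹ • (fermatLinearCycleFunctional t₁ e + (κ₁ * κ₂⁻¹) • fermatLinearCycleFunctional t₂ e) := by
    rw [h₁, h₂, smul_add, smul_smul, smul_smul, smul_smul, inv_mul_cancel₀ hκ₁, one_smul,
      show κ₁⁻¹ * (κ₁ * κ₂⁻¹) * κ₂ = 1 by field_simp, one_smul]
  rw [hψ, annIdeal_smul _ (inv_ne_zero hκ₁)]

/-- **The printed claim, colon-ideal form, any pair of distinct cycles.** For `J = (x_i^e)` on the pairs `τ`,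
`e = d − 1 ≥ 2`, twist vectors `t₁ ≠ t₂` and constants `a₁, a₂ ≠ 0`:
`(J : a₁P_{t₁})_k ∩ (J : a₂P_{t₂})_k = (J : a₁P_{t₁} + a₂P_{t₂})_k ⟺ k < #D·(e−1) ∨ k > #τ·(e−1)`
(`#D` = number of pairs where `t₁, t₂` differ). [cite: Villaflor2022PeriodsCI, Theorem 3 (proof), Remark 7] -/
theorem idealDegree_colon_inf_eq_colon_add_iff (he : 2 ≤ e) {t₁ t₂ : τ → K} (ht : t₁ ≠ t₂) {a₁ a₂ : K}
    (ha₁ : a₁ ≠ 0) (ha₂ : a₂ ≠ 0) (k : ℕ) :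
    idealDegree ((Ideal.span (Set.range fun i : τ ⊕ τ => (X i : MvPolynomial (τ ⊕ τ) K) ^ e)).colon
          {C a₁ * fermatLinearCyclePolynomial t₁ e} ⊓
        (Ideal.span (Set.range fun i : τ ⊕ τ => (X i : MvPolynomial (τ ⊕ τ) K) ^ e)).colon
          {C a₂ * fermatLinearCyclePolynomial t₂ e}) k =
      idealDegree ((Ideal.span (Set.range fun i : τ ⊕ τ => (X i : MvPolynomial (τ ⊕ τ) K) ^ e)).colon
          {C a₁ * fermatLinearCyclePolynomial t₁ e + C a₂ * fermatLinearCyclePolynomial t₂ e}) k ↔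
      k < (diffPairs t₁ t₂).card * (e - 1) ∨ Fintype.card τ * (e - 1) < k := by
  obtain ⟨w, hw, hcolon⟩ := exists_colon_add_eq_annIdeal e (by omega) ha₁ ha₂ t₁ t₂
  rw [hcolon, colon_C_mul_fermatLinearCyclePolynomial_eq_annIdeal e (by omega) ha₁,
    colon_C_mul_fermatLinearCyclePolynomial_eq_annIdeal e (by omega) ha₂]
  exact idealDegree_inf_eq_annIdeal_add_smul_iff t₁ t₂ e he ht hw k

end TwoCycles

/-! ## Proposition 1 and the claim of the proof of Theorem 3, as printed -/

section Printed

variable [DecidableEq K]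

omit [Field K] [DecidableEq K] in
/-- `#{j : Fin p | j < r} = r` for `r ≤ p`. [folklore] -/
private theorem card_filter_val_lt {p r : ℕ} (hrp : r ≤ p) :
    (Finset.univ.filter fun j : Fin p => (j : ℕ) < r).card = r := by
  have h : (Finset.univ.filter fun j : Fin p => (j : ℕ) < r).map Fin.valEmbedding = Finset.range r := by
    ext x
    simp only [Finset.mem_map, Finset.mem_filter, Finset.mem_univ, true_and, Fin.valEmbedding_apply,
      Finset.mem_range]
    constructor
    · rintro ⟨j, hj, rfl⟩
      exact hj
    · intro hx
      exact ⟨⟨x, by omega⟩, hx, rfl⟩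
  rw [← Finset.card_map Fin.valEmbedding, h, Finset.card_range]

/-- **Villaflor 2022, Proposition 1** (over any field `K`; `r ≥ 1` pairs `(x_{2j}, x_{2j+1})`, `j < r`, indexed by
`Sum.inl j ↔ x_{2j}`, `Sum.inr j ↔ x_{2j+1}`; `d ≥ 3`; `β₁ ≠ β₂`, `c₁, c₂ ≠ 0`): with
`I = ⟨x_0^{d−1}, …, x_{2r−1}^{d−1}⟩` and `R_i = c_i ∏_j (x_{2j}^{d−1} − (β_ix_{2j+1})^{d−1})/(x_{2j} − β_ix_{2j+1})`,
**`(I : R₁)_e ∩ (I : R₂)_e = (I : R₁ + R₂)_e` if and only if `e ≠ (d−2)·r`.** (The printed hypothesis `β_i ≠ 0` is not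
needed.) [cite: Villaflor2022PeriodsCI, Proposition 1] -/
theorem Villaflor2022_prop1 {r d : ℕ} (hr : 1 ≤ r) (hd : 3 ≤ d) {β₁ β₂ c₁ c₂ : K} (hβ : β₁ ≠ β₂)
    (hc₁ : c₁ ≠ 0) (hc₂ : c₂ ≠ 0) (e : ℕ) :
    idealDegree ((Ideal.span (Set.range fun i : Fin r ⊕ Fin r =>
          (X i : MvPolynomial (Fin r ⊕ Fin r) K) ^ (d - 1))).colon
          {C c₁ * fermatLinearCyclePolynomial (fun _ : Fin r => β₁) (d - 1)} ⊓
        (Ideal.span (Set.range fun i : Fin r ⊕ Fin r => (X i : MvPolynomial (Fin r ⊕ Fin r) K) ^ (d - 1))).colon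
          {C c₂ * fermatLinearCyclePolynomial (fun _ : Fin r => β₂) (d - 1)}) e =
      idealDegree ((Ideal.span (Set.range fun i : Fin r ⊕ Fin r =>
          (X i : MvPolynomial (Fin r ⊕ Fin r) K) ^ (d - 1))).colon
          {C c₁ * fermatLinearCyclePolynomial (fun _ : Fin r => β₁) (d - 1) +
            C c₂ * fermatLinearCyclePolynomial (fun _ : Fin r => β₂) (d - 1)}) e ↔
      e ≠ (d - 2) * r := by
  have ht : (fun _ : Fin r => β₁) ≠ (fun _ : Fin r => β₂) := fun h =>
    hβ (congr_fun h ⟨0, hr⟩)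
  rw [idealDegree_colon_inf_eq_colon_add_iff (d - 1) (by omega) ht hc₁ hc₂ e]
  have hD : (diffPairs (fun _ : Fin r => β₁) (fun _ : Fin r => β₂)).card = r := by
    rw [diffPairs, Finset.filter_true_of_mem fun j _ => hβ, Finset.card_univ, Fintype.card_fin]
  rw [hD, Fintype.card_fin, show d - 1 - 1 = d - 2 by omega, mul_comm]
  omega

/-- **Villaflor 2022, the claim of the proof of Theorem 3** (over any field `K`; `n/2 + 1 = p` pairs
`(x_{2j}, x_{2j+1})`, `Sum.inl j ↔ x_{2j}`, `Sum.inr j ↔ x_{2j+1}`; `d ≥ 3`; `r = n/2 − m` with `1 ≤ r ≤ p`; `ζ ∈ K`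
and exponents `α_j` with `ζ^{α_j} ≠ ζ` for `j < r`, e.g. `ζ = ζ_{2d}` and `α_j ∈ {3, 5, …, 2d−1}`; `c₁, c₂ ≠ 0`): with
`J^F = ⟨x_0^{d−1}, …, x_{n+1}^{d−1}⟩`, `P₁ = c₁ ∏_{j} (x_{2j}^{d−1} − (ζx_{2j+1})^{d−1})/(x_{2j} − ζx_{2j+1})` (`= R₁Q`)
and `P₂ = c₂ ∏_{j<r} (x_{2j}^{d−1} − (ζ^{α_j}x_{2j+1})^{d−1})/(x_{2j} − ζ^{α_j}x_{2j+1}) · ∏_{j ≥ r} (… ζ …)` (`= R₂Q`),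
**`(J^F : P₁)_e ∩ (J^F : P₂)_e = (J^F : P₁ + P₂)_e` if and only if `e < (d−2)(n/2 − m)` or `e > (d−2)(n/2 + 1)`**
— here `(d−2)·r` and `(d−2)·p`. [cite: Villaflor2022PeriodsCI, Theorem 3 (proof), Remark 7] -/
theorem Villaflor2022_thm3_colon {p r d : ℕ} (hr : 1 ≤ r) (hrp : r ≤ p) (hd : 3 ≤ d) (ζ : K) (α : Fin p → ℕ)
    (hα : ∀ j : Fin p, (j : ℕ) < r → ζ ^ α j ≠ ζ) {c₁ c₂ : K} (hc₁ : c₁ ≠ 0) (hc₂ : c₂ ≠ 0) (e : ℕ) :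
    idealDegree ((Ideal.span (Set.range fun i : Fin p ⊕ Fin p =>
          (X i : MvPolynomial (Fin p ⊕ Fin p) K) ^ (d - 1))).colon
          {C c₁ * fermatLinearCyclePolynomial (fun _ : Fin p => ζ) (d - 1)} ⊓
        (Ideal.span (Set.range fun i : Fin p ⊕ Fin p => (X i : MvPolynomial (Fin p ⊕ Fin p) K) ^ (d - 1))).colon
          {C c₂ * fermatLinearCyclePolynomial (fun j : Fin p => if (j : ℕ) < r then ζ ^ α j else ζ) (d - 1)}) e =
      idealDegree ((Ideal.span (Set.range fun i : Fin p ⊕ Fin p =>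
          (X i : MvPolynomial (Fin p ⊕ Fin p) K) ^ (d - 1))).colon
          {C c₁ * fermatLinearCyclePolynomial (fun _ : Fin p => ζ) (d - 1) +
            C c₂ * fermatLinearCyclePolynomial (fun j : Fin p => if (j : ℕ) < r then ζ ^ α j else ζ) (d - 1)}) e ↔
      e < (d - 2) * r ∨ (d - 2) * p < e := by
  have hr0 : ((⟨0, by omega⟩ : Fin p) : ℕ) < r := hr
  have ht : (fun _ : Fin p => ζ) ≠ (fun j : Fin p => if (j : ℕ) < r then ζ ^ α j else ζ) := by
    intro h
    have h0 := congr_fun h ⟨0, by omega⟩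
    simp only [hr0, if_true] at h0
    exact hα ⟨0, by omega⟩ hr0 h0.symm
  rw [idealDegree_colon_inf_eq_colon_add_iff (d - 1) (by omega) ht hc₁ hc₂ e]
  have hD : (diffPairs (fun _ : Fin p => ζ) (fun j : Fin p => if (j : ℕ) < r then ζ ^ α j else ζ)).card = r := by
    have hfilter : diffPairs (fun _ : Fin p => ζ) (fun j : Fin p => if (j : ℕ) < r then ζ ^ α j else ζ) =
        Finset.univ.filter fun j : Fin p => (j : ℕ) < r := by
      ext j
      simp only [mem_diffPairs, Finset.mem_filter, Finset.mem_univ, true_and]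
      constructor
      · intro h
        by_contra hj
        rw [if_neg hj] at h
        exact h rfl
      · intro hj
        rw [if_pos hj]
        exact (hα j hj).symm
    rw [hfilter, card_filter_val_lt hrp]
  rw [hD, Fintype.card_fin, show d - 1 - 1 = d - 2 by omega, mul_comm r, mul_comm p]

end Printed

end Literature.AlgebraicGeometry.Villaflor2022

end
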